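import Literature.ModelTheory.ExponentialFields.SemialgebraicAngleDeriv
import Literature.ModelTheory.ExponentialFields.SemialgebraicFreeWindowCuts
import Literature.ModelTheory.ExponentialFields.SemialgebraicC1Cells
import Literature.NumberTheory.Transcendental.SemialgebraicMonotonicityDefinable
import Mathlib.Topology.Baire.CompleteMetrizable
import HarnessLib

/-!
# Wings: the tangential derivatives at generic vertex points (Pawłucki's Lemma 5.4, `p = 1`, step (c))

Topic `Literature/ModelTheory/ExponentialFields` — block B4₆ of the proof of the
`C¹`-triangulation theorem for compact semialgebraic sets
(`Literature.ModelTheory.ExponentialFields.OhmotoShiota2017_c1Triangulation`, statement of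
[OhmotoShiota2017, Thm. 1.1]) along the proof of [Pawlucki2024], specialized to `p = 1`.

Tools for the wing argument of [Pawlucki2024, proof of Lemma 5.4, (5.4.3)–(5.4.8)]: Baire
uniformization on balls; the squeeze `‖y‖ ≤ C |y₁|` for points of a generalized angle near a vertex;
the bottom band of a `C¹` cell decomposition above the zero section ("by … the Cell Decomposition
Theorem there exist a nonempty open `G'`, `δ > 0` and a continuous mapping `α`", (5.4.4)–(5.4.5)).

No named facts are introduced (D-0026).

## References

* [Pawlucki2024] W. Pawłucki, *Strict `C^p`-triangulations — a new approach to
  desingularization*, J. Eur. Math. Soc. 26 (2024), 3863–3909, Lemma 5.4 (proof, p = 1).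
* [Dries1998] L. van den Dries, *Tame topology and o-minimal structures*, Ch. 3 (2.11), Ch. 6 (1.2).
-/

noncomputable section

open Set Filter Metric
open _root_.Topology

namespace Literature.ModelTheory.ExponentialFields

open Literature.NumberTheory.Transcendental (IsSemialgebraicFunOn IsSemialgebraicMapOn
  isSemialgebraicFunOn_iff isSemialgebraicMapOn_iff_forall_holds)

section WingTools

variable {m : ℕ}

/-! ### Baire uniformization on an open set -/

/-- **Baire uniformization**: if an open nonempty set is covered by countably many closed sets, one
of them contains a ball inside the open set (Baire category theorem). [folklore] -/
theorem exists_ball_subset_of_iUnion_closed {G : Set (Fin m → ℝ)} (hG : IsOpen G) (hne : G.Nonempty)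
    (F : ℕ → Set (Fin m → ℝ)) (hF : ∀ N, IsClosed (F N)) (hcov : G ⊆ ⋃ N, F N) :
    ∃ (N : ℕ) (a : Fin m → ℝ) (r : ℝ), 0 < r ∧ ball a r ⊆ G ∩ F N := by
  set F' : ℕ → Set (Fin m → ℝ) := fun N => F N ∪ Gᶜ with hF'
  have hF'c : ∀ N, IsClosed (F' N) := fun N => (hF N).union hG.isClosed_compl
  have hcov' : ⋃ N, F' N = univ := by
    refine eq_univ_of_forall fun x => ?_
    by_cases hx : x ∈ G
    · obtain ⟨N, hN⟩ := mem_iUnion.1 (hcov hx); exact mem_iUnion.2 ⟨N, Or.inl hN⟩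
    · exact mem_iUnion.2 ⟨0, Or.inr hx⟩
  have hd : Dense (⋃ N, interior (F' N)) := dense_iUnion_interior_of_closed hF'c hcov'
  obtain ⟨x, hxG, hxU⟩ := hd.inter_open_nonempty G hG hne
  obtain ⟨N, hxN⟩ := mem_iUnion.1 hxU
  have hopen : IsOpen (G ∩ interior (F' N)) := hG.inter isOpen_interior
  obtain ⟨r, hr, hball⟩ := Metric.isOpen_iff.1 hopen x ⟨hxG, hxN⟩
  refine ⟨N, x, r, hr, fun y hy => ?_⟩
  obtain ⟨hyG, hyN⟩ := hball hy
  rcases interior_subset hyN with h | h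
  · exact ⟨hyG, h⟩
  · exact absurd hyG h

end WingTools

/-! ### The squeeze `‖y‖ ≤ C |y₁|` near a vertex -/

section Squeeze

variable {k : ℕ}

/-- **Level functions are `O(‖y‖)` near the vertex**: for a level `ℓ'` on top of a tower `T` of
height `j + 1`, both `φ'` and `ψ'` satisfy `|φ'(w)|, |ψ'(w)| ≤ C ‖y_w‖` near `(a, 0)`.
[cite: Pawlucki2024, Lemma 5.4 (proof, "Since `φ_{k+2}(u, x_{k+1}) < α_{k+2} < ψ_{k+2}`…")] -/
theorem exists_level_bound {Ω : Set (Fin k → ℝ)} (hΩ : IsOpen Ω) {a : Fin k → ℝ} (ha : a ∈ Ω) (j : ℕ)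
    (T : Tower k (j + 1)) (ℓ' : Level (k + (j + 1))) (H : Tower.Hyp Ω (j + 1 + 1) ⟨T, ℓ'⟩) :
    ∃ (C R : ℝ), 0 ≤ C ∧ 0 < R ∧ ∀ w ∈ angle Ω (j + 1) T, dist w (spinePt (j + 1) a) < R → ypart (j + 1) w ≠ 0 →
      |ℓ'.φ w| ≤ C * ‖ypart (j + 1) w‖ ∧ |ℓ'.ψ w| ≤ C * ‖ypart (j + 1) w‖ := by
  obtain ⟨HT, ⟨V, hVo, hAV, hφ, hψ⟩, -, hpinch, -⟩ := H
  set pt := spinePt (j + 1) a with hpt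
  have hpt_mem : pt ∈ angle Ω (j + 1) T := spinePt_mem_angle ha (j + 1) T HT
  have hptV : pt ∈ V := hAV hpt_mem
  obtain ⟨Cv, hCv0, hVE⟩ := vertex_estimate hΩ ha j T HT
  -- a common local bound `L` for `Dφ'`, `Dψ'`
  set L : ℝ := ‖fderiv ℝ ℓ'.φ pt‖ + ‖fderiv ℝ ℓ'.ψ pt‖ + 1 with hL
  have hL0 : 0 ≤ L := by positivity
  have hφd : DifferentiableOn ℝ ℓ'.φ V := hφ.differentiableOn one_ne_zero
  have hψd : DifferentiableOn ℝ ℓ'.ψ V := hψ.differentiableOn one_ne_zero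
  have hbd : ∀ {g : (Fin (k + (j + 1)) → ℝ) → ℝ}, ContDiffOn ℝ 1 g V → ‖fderiv ℝ g pt‖ + 1 ≤ L →
      ∃ Rg > 0, ball pt Rg ⊆ V ∧ ∀ w ∈ ball pt Rg, ‖fderiv ℝ g w‖ ≤ L := by
    intro g hg hgL
    have hc : ContinuousAt (fun w => fderiv ℝ g w) pt := (hg.continuousOn_fderiv_of_isOpen hVo le_rfl).continuousAt (hVo.mem_nhds hptV)
    have h1 : ∀ᶠ w in 𝓝 pt, dist (fderiv ℝ g w) (fderiv ℝ g pt) < 1 := Metric.tendsto_nhds.1 hc.tendsto 1 one_pos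
    obtain ⟨Rg, hRg, h⟩ := Metric.eventually_nhds_iff.1 (h1.and (hVo.mem_nhds hptV))
    refine ⟨Rg, hRg, fun w hw => (h hw).2, fun w hw => ?_⟩
    have h' := (h (mem_ball.1 hw)).1
    rw [dist_eq_norm] at h'
    calc ‖fderiv ℝ g w‖ = ‖(fderiv ℝ g w - fderiv ℝ g pt) + fderiv ℝ g pt‖ := by rw [sub_add_cancel]
      _ ≤ ‖fderiv ℝ g w - fderiv ℝ g pt‖ + ‖fderiv ℝ g pt‖ := norm_add_le _ _
      _ ≤ L := by linarith
  obtain ⟨Rφ₀, hRφ₀, -, hφbd⟩ := hbd hφ (by rw [hL]; linarith [norm_nonneg (fderiv ℝ ℓ'.ψ pt)])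
  obtain ⟨Rψ₀, hRψ₀, -, hψbd⟩ := hbd hψ (by rw [hL]; linarith [norm_nonneg (fderiv ℝ ℓ'.φ pt)])
  set RL := min Rφ₀ Rψ₀ with hRL
  have hRL0 : 0 < RL := lt_min hRφ₀ hRψ₀
  have hgrad : ∀ {g : (Fin (k + (j + 1)) → ℝ) → ℝ}, DifferentiableOn ℝ g V → (∀ w ∈ ball pt RL, ‖fderiv ℝ g w‖ ≤ L) →
      GradHyp Ω (j + 1) T a RL L g := by
    intro g hgd hgbd
    refine ⟨V, hVo, fun z hz _ _ => hAV hz, hgd, fun z hz hdz _ i => ?_⟩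
    calc |(fderiv ℝ g z) (Pi.single (Fin.natAdd k i) 1)| = ‖(fderiv ℝ g z) (Pi.single (Fin.natAdd k i) 1)‖ := (Real.norm_eq_abs _).symm
      _ ≤ ‖fderiv ℝ g z‖ * ‖(Pi.single (Fin.natAdd k i) (1 : ℝ) : Fin (k + (j + 1)) → ℝ)‖ := ContinuousLinearMap.le_opNorm _ _
      _ ≤ L * 1 := by rw [norm_single_one]; exact mul_le_mul_of_nonneg_right (hgbd z (mem_ball.2 hdz)) zero_le_one
      _ = L := mul_one L
  have hφG : GradHyp Ω (j + 1) T a RL L ℓ'.φ := hgrad hφd fun w hw => hφbd w (mem_ball.2 ((mem_ball.1 hw).trans_le (min_le_left _ _)))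
  have hψG : GradHyp Ω (j + 1) T a RL L ℓ'.ψ := hgrad hψd fun w hw => hψbd w (mem_ball.2 ((mem_ball.1 hw).trans_le (min_le_right _ _)))
  obtain ⟨Rv, hRv, hest⟩ := hVE RL hRL0
  refine ⟨Cv * L, Rv, mul_nonneg hCv0 hL0, hRv, fun w hw hdw hyw => ?_⟩
  have huΩ : upart (j + 1) w ∈ Ω := upart_mem_of_mem_angle (j + 1) T hw
  have hsp : spinePt (j + 1) (upart (j + 1) w) ∈ angle Ω (j + 1) T := spinePt_mem_angle huΩ (j + 1) T HT
  have hcont : ∀ {g : (Fin (k + (j + 1)) → ℝ) → ℝ}, ContDiffOn ℝ 1 g V → ContinuousWithinAt g (angle Ω (j + 1) T) (spinePt (j + 1) (upart (j + 1) w)) :=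
    fun hg => ((hg.continuousOn _ (hAV hsp)).continuousAt (hVo.mem_nhds (hAV hsp))).continuousWithinAt
  obtain ⟨hφ0, hψ0⟩ := hpinch _ hsp (ypart_spinePt _ _)
  constructor
  · have h := hest L ℓ'.φ hL0 hφG w hw hdw hyw
    rw [spineLim_eq_of_continuousWithinAt j T HT huΩ (hcont hφ), hφ0, sub_zero] at h
    exact h
  · have h := hest L ℓ'.ψ hL0 hψG w hw hdw hyw
    rw [spineLim_eq_of_continuousWithinAt j T HT huΩ (hcont hψ), hψ0 (Nat.succ_pos j), sub_zero] at h
    exact h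

/-- The first fibre coordinate is preserved by `init`. [cite: Pawlucki2024, Lemma 5.4] -/
theorem ypart_init_zero (j : ℕ) (z : Fin (k + (j + 1 + 1)) → ℝ) : ypart (j + 1) (Fin.init z) 0 = ypart (j + 1 + 1) z 0 := by
  rw [ypart_init]; rfl

/-- **The squeeze `‖y‖ ≤ C |y₁|`** for points of the angle near a vertex.
[cite: Pawlucki2024, Lemma 5.4 (proof)] -/
theorem exists_norm_ypart_le {Ω : Set (Fin k → ℝ)} (hΩ : IsOpen Ω) {a : Fin k → ℝ} (ha : a ∈ Ω) :
    ∀ (j : ℕ) (T : Tower k (j + 1)), Tower.Hyp Ω (j + 1) T →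
      ∃ (C R : ℝ), 0 ≤ C ∧ 0 < R ∧ ∀ z ∈ angle Ω (j + 1) T, dist z (spinePt (j + 1) a) < R →
        ‖ypart (j + 1) z‖ ≤ C * |ypart (j + 1) z 0|
  | 0, ⟨T, ℓ⟩, _ => by
    refine ⟨1, 1, zero_le_one, one_pos, fun z _ _ => ?_⟩
    rw [norm_ypart_one, one_mul, ← ypart_last 0 z]
    rfl
  | j + 1, ⟨T, ℓ'⟩, H => by
    obtain ⟨C, R, hC, hR, hIH⟩ := exists_norm_ypart_le hΩ ha j T H.1
    obtain ⟨Cl, Rl, hCl, hRl, hlev⟩ := exists_level_bound hΩ ha j T ℓ' H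
    refine ⟨(1 + Cl) * C, min R Rl, by positivity, lt_min hR hRl, fun z hz hdz => ?_⟩
    have hdw : dist (Fin.init z) (spinePt (j + 1) a) < min R Rl := (dist_init_spinePt_le (j + 1) z a).trans_lt hdz
    have hw : Fin.init z ∈ angle Ω (j + 1) T := hz.1
    have hy : ypart (j + 1 + 1) z = Fin.snoc (ypart (j + 1) (Fin.init z)) (z (Fin.last (k + (j + 1)))) := ypart_succ_eq_snoc (j + 1) z
    rw [← ypart_init_zero j z, hy, norm_snoc_max]
    by_cases hyw : ypart (j + 1) (Fin.init z) = 0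
    · have ht : z (Fin.last (k + (j + 1))) = 0 := last_eq_zero_of_ypart_init H (Nat.succ_pos j) hz hyw
      rw [hyw, ht, norm_zero, abs_zero, max_self]
      simp
    · obtain ⟨hφ, hψ⟩ := hlev _ hw (hdw.trans_le (min_le_right _ _)) hyw
      have hIHw := hIH _ hw (hdw.trans_le (min_le_left _ _))
      have ht : |z (Fin.last (k + (j + 1)))| ≤ Cl * ‖ypart (j + 1) (Fin.init z)‖ :=
        (abs_le_max_abs_abs hz.2.1 hz.2.2).trans (max_le hφ hψ)
      have h1 : max ‖ypart (j + 1) (Fin.init z)‖ |z (Fin.last (k + (j + 1)))| ≤ (1 + Cl) * ‖ypart (j + 1) (Fin.init z)‖ := by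
        refine max_le ?_ (ht.trans ?_)
        · exact le_mul_of_one_le_left (norm_nonneg _) (le_add_of_nonneg_right hCl)
        · rw [add_mul, one_mul]; exact le_add_of_nonneg_left (norm_nonneg _)
      calc max ‖ypart (j + 1) (Fin.init z)‖ |z (Fin.last (k + (j + 1)))| ≤ (1 + Cl) * ‖ypart (j + 1) (Fin.init z)‖ := h1
        _ ≤ (1 + Cl) * (C * |ypart (j + 1) (Fin.init z) 0|) := mul_le_mul_of_nonneg_left hIHw (by positivity)
        _ = (1 + Cl) * C * |ypart (j + 1) (Fin.init z) 0| := by ring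

end Squeeze

/-! ### The bottom band above the zero section -/

section Band

variable {k : ℕ}

/-- A set to which a decomposition is adapted is the union of the cells it contains. [folklore] -/
theorem eq_sUnion_filter_of_adapted {𝒟 : Finset (Set (Fin (k + 1) → ℝ))}
    (hpart : Setoid.IsPartition (𝒟 : Set (Set (Fin (k + 1) → ℝ)))) {s : Set (Fin (k + 1) → ℝ)}
    (hadapt : ∀ C ∈ 𝒟, C ⊆ s ∨ Disjoint C s) [DecidablePred fun C : Set (Fin (k + 1) → ℝ) => C ⊆ s] :
    s = ⋃₀ ((𝒟.filter fun C => C ⊆ s : Finset _) : Set (Set (Fin (k + 1) → ℝ))) := by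
  ext z
  simp only [mem_sUnion, Finset.coe_filter, mem_setOf_eq]
  constructor
  · intro hz
    obtain ⟨C, ⟨hC, hzC⟩, -⟩ := hpart.2 z
    rcases hadapt C hC with h | h
    · exact ⟨C, ⟨hC, h⟩, hzC⟩
    · exact absurd hz (disjoint_left.1 h hzC)
  · rintro ⟨C, ⟨-, hCs⟩, hzC⟩
    exact hCs hzC

/-- **The bottom band** [Pawlucki2024, proof of Lemma 5.4, (5.4.4): "by the Cell Decomposition
Theorem there exist a nonempty open subset `G'` … and `δ > 0` such that `G' × [0, δ) ⊆ [φ, ψ)`, and a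
continuous mapping `α`"]: for an open semialgebraic `B ⊆ ℝᵏ`, a semialgebraic `P ⊆ B × (0, ∞)`
accumulating at every point of `B × {0}`, and finitely many semialgebraic functions on `P`, there is a
nonempty open semialgebraic `S ⊆ B` and a continuous `ξ > 0` on `S` such that the band
`{(u, t) : u ∈ S, 0 < t < ξ u}` lies in `P` and the functions are `C¹` on it.
[cite: Pawlucki2024, Lemma 5.4 (proof, (5.4.4)); Dries1998, Ch. 3 (2.11)] -/
theorem exists_bottom_band {B : Set (Fin k → ℝ)} (hBo : IsOpen B) (hBs : IsSemialgebraic ℝ B) (hBne : B.Nonempty)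
    {P : Set (Fin (k + 1) → ℝ)} (hPs : IsSemialgebraic ℝ P) (hPB : P ⊆ {z | Fin.init z ∈ B ∧ 0 < z (Fin.last k)})
    (hcl : ∀ a ∈ B, (Fin.snoc a 0 : Fin (k + 1) → ℝ) ∈ closure P)
    {ι : Type} [Fintype ι] (F : ι → (Fin (k + 1) → ℝ) → ℝ) (hF : ∀ i, IsSemialgebraicFunOn ℝ P (F i)) :
    ∃ (S : Set (Fin k → ℝ)) (ξ : (Fin k → ℝ) → ℝ), IsOpen S ∧ IsSemialgebraic ℝ S ∧ S.Nonempty ∧ S ⊆ B ∧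
      ContinuousOn ξ S ∧ (∀ u ∈ S, 0 < ξ u) ∧
      (∀ z : Fin (k + 1) → ℝ, Fin.init z ∈ S → 0 < z (Fin.last k) → z (Fin.last k) < ξ (Fin.init z) → z ∈ P) ∧
      ∀ i, IsC1On (F i) {z | Fin.init z ∈ S ∧ 0 < z (Fin.last k) ∧ z (Fin.last k) < ξ (Fin.init z)} := by
  classical
  -- the adapted `C¹` decomposition
  set Γ0 : Set (Fin (k + 1) → ℝ) := graphOver B (fun _ => (0 : ℝ)) with hΓ0
  set cylB : Set (Fin (k + 1) → ℝ) := {z | Fin.init z ∈ B} with hcylB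
  have hΓ0sa : IsSemialgebraic ℝ Γ0 := isSemialgebraicFunOn_iff.mp (isSemialgebraicFunOn_const' hBs 0)
  have hcylsa : IsSemialgebraic ℝ cylB := hBs.setOf_init_mem
  set 𝒜 : Finset (Set (Fin (k + 1) → ℝ)) := {P, Γ0, cylB} with h𝒜
  have h𝒜sa : ∀ A ∈ 𝒜, IsSemialgebraic ℝ A := by
    intro A hA
    simp only [h𝒜, Finset.mem_insert, Finset.mem_singleton] at hA
    rcases hA with rfl | rfl | rfl
    · exact hPs
    · exact hΓ0sa
    · exact hcylsa
  obtain ⟨𝒟, h𝒟, hadapt, hcellsP, hC1⟩ := (c1_cell_decomposition (k + 1)).2 ι (fun _ => P) F hF 𝒜 h𝒜sa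
  have hCD : IsCylindricalDecomposition ℝ (k + 1) 𝒟 := h𝒟.1
  have hCD' := hCD
  rw [isCylindricalDecomposition_succ] at hCD'
  obtain ⟨hpart, -, ℬ, hℬ, L, ξs, hc, hs, hmono, hcells⟩ := hCD'
  have hst : IsStackOf ℬ 𝒟 L ξs := ⟨hc, hs, hmono, hcells⟩
  have hmemA : ∀ s, s = P ∨ s = Γ0 ∨ s = cylB → s ∈ 𝒜 := by
    intro s hs'; simp only [h𝒜, Finset.mem_insert, Finset.mem_singleton]; tauto
  -- unions of cells
  have hP_eq := eq_sUnion_filter_of_adapted hpart (hadapt P (hmemA _ (Or.inl rfl)))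
  have hΓ_eq := eq_sUnion_filter_of_adapted hpart (hadapt Γ0 (hmemA _ (Or.inr (Or.inl rfl))))
  have hcyl_eq := eq_sUnion_filter_of_adapted hpart (hadapt cylB (hmemA _ (Or.inr (Or.inr rfl))))
  -- base cells inside `B` or disjoint; an open base cell inside `B`
  have hbase : ∀ S ∈ ℬ, S ⊆ B ∨ Disjoint S B := fun S hS =>
    base_subset_or_disjoint hpart hst (Finset.filter_subset _ _) hcyl_eq hS
  have hℬpart := hℬ.isPartition
  have hBunion : B = ⋃ S ∈ ℬ.filter (fun S => S ⊆ B), S := by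
    ext u; simp only [mem_iUnion, Finset.mem_filter, exists_prop]
    constructor
    · intro hu
      obtain ⟨S, ⟨hS, huS⟩, -⟩ := hℬpart.2 u
      rcases hbase S hS with h | h
      · exact ⟨S, ⟨hS, h⟩, huS⟩
      · exact absurd hu (disjoint_left.1 h huS)
    · rintro ⟨S, ⟨-, hSB⟩, huS⟩; exact hSB huS
  obtain ⟨S₀, hS₀ℬ, hS₀B, hS₀dim⟩ : ∃ S₀ ∈ ℬ, S₀ ⊆ B ∧ sdim S₀ = k := by
    by_contra hno
    push Not at hno
    have hle : sdim B ≤ k - 1 := by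
      rw [hBunion]
      refine sdim_biUnion_le _ _ (fun S hS => hℬ.isSemialgebraic S (Finset.mem_filter.1 hS).1) fun S hS => ?_
      obtain ⟨hSℬ, hSB⟩ := Finset.mem_filter.1 hS
      have h1 := sdim_le S
      have h2 := hno S hSℬ hSB
      omega
    have hk : sdim B = k := sdim_eq_of_interior_nonempty (by rwa [hBo.interior_eq])
    rcases Nat.eq_zero_or_pos k with h0 | hpos
    · -- `k = 0`: every cell has dimension `0 = k`
      obtain ⟨u, hu⟩ := hBne
      obtain ⟨S, ⟨hS, huS⟩, -⟩ := hℬpart.2 u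
      have hSB : S ⊆ B := by
        rcases hbase S hS with h | h
        · exact h
        · exact absurd hu (disjoint_left.1 h huS)
      have := hno S hS hSB
      have := sdim_le S
      omega
    · omega
  obtain ⟨d, hcellS₀⟩ := IsCylindricalDecomposition.exists_isSACell (k := ℝ) hℬ S₀ hS₀ℬ
  have hdS₀ : d = k := by rw [← hcellS₀.sdim_eq]; exact hS₀dim
  have hS₀o : IsOpen S₀ := hcellS₀.isOpen hdS₀
  have hS₀sa : IsSemialgebraic ℝ S₀ := hℬ.isSemialgebraic S₀ hS₀ℬ
  have hS₀ne : S₀.Nonempty := by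
    by_contra h; rw [not_nonempty_iff_eq_empty] at h; exact hℬpart.1 (h ▸ hS₀ℬ)
  -- the zero section over `S₀`
  obtain ⟨m, hm⟩ := exists_section_eq hℬpart hst (Finset.filter_subset _ _) hΓ_eq hS₀ℬ hS₀B
  -- the band above it and its upper boundary
  set mb : Fin (L S₀ + 1) := m.succ with hmb
  have hmb0 : mb ≠ 0 := Fin.succ_ne_zero m
  set ξ : (Fin k → ℝ) → ℝ := fun u => if h : mb = Fin.last (L S₀) then 1 else min 1 (ξs S₀ (mb.castPred h) u) with hξ
  have hξcont : ContinuousOn ξ S₀ := by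
    simp only [hξ]
    split_ifs with h
    · exact continuousOn_const
    · exact continuousOn_min₂ continuousOn_const (hc S₀ hS₀ℬ _)
  have hξpos : ∀ u ∈ S₀, 0 < ξ u := by
    intro u hu
    simp only [hξ]
    split_ifs with h
    · exact one_pos
    · refine lt_min one_pos ?_
      have hlt : m < mb.castPred h := by
        rw [Fin.lt_def, Fin.coe_castPred, hmb, Fin.val_succ]; exact Nat.lt_succ_self _
      have h1 : ξs S₀ m u < ξs S₀ (mb.castPred h) u := hmono S₀ hS₀ℬ u hu hlt
      rwa [hm u hu] at h1
  -- points of the sub-band are in the band cell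
  have hband_mem : ∀ z : Fin (k + 1) → ℝ, Fin.init z ∈ S₀ → 0 < z (Fin.last k) → z (Fin.last k) < ξ (Fin.init z) →
      z ∈ bandOver S₀ (ξs S₀) mb := by
    intro z hz h0 hξz
    rw [mem_bandOver_iff]
    refine ⟨hz, ?_, ?_⟩
    · rw [hmb, bandLower_succ, hm _ hz]; exact_mod_cast h0
    · by_cases h : mb = Fin.last (L S₀)
      · rw [h, bandUpper_last]; exact EReal.coe_lt_top _
      · rw [bandUpper_of_ne_last _ _ h]
        have : ξ (Fin.init z) ≤ ξs S₀ (mb.castPred h) (Fin.init z) := by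
          simp only [hξ, dif_neg h]; exact min_le_right _ _
        exact_mod_cast hξz.trans_le this
  have hTb : bandOver S₀ (ξs S₀) mb ∈ 𝒟 := (hcells _).2 ⟨S₀, hS₀ℬ, Or.inr ⟨mb, rfl⟩⟩
  -- the band cell lies in `P`
  have hTbP : bandOver S₀ (ξs S₀) mb ⊆ P := by
    rcases hadapt P (hmemA _ (Or.inl rfl)) _ hTb with h | h
    · exact h
    · exfalso
      obtain ⟨a, ha⟩ := hS₀ne
      -- the neighbourhood `{init ∈ S₀, last < ξ ∘ init}` of `(a, 0)` misses `P`
      have hO : IsOpen {z : Fin (k + 1) → ℝ | (Fin.init z : Fin k → ℝ) ∈ S₀} := hS₀o.preimage (continuous_pi fun i => continuous_apply _)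
      have hN : IsOpen {z : Fin (k + 1) → ℝ | z ∈ {z : Fin (k + 1) → ℝ | (Fin.init z : Fin k → ℝ) ∈ S₀} ∧ z (Fin.last k) < ξ (Fin.init z)} :=
        LadderData.isOpen_sep_lt hO (continuous_apply _).continuousOn (hξcont.comp (continuous_pi fun i => continuous_apply _).continuousOn fun z hz => hz)
      have hmemN : (Fin.snoc a 0 : Fin (k + 1) → ℝ) ∈ {z : Fin (k + 1) → ℝ | z ∈ {z : Fin (k + 1) → ℝ | (Fin.init z : Fin k → ℝ) ∈ S₀} ∧ z (Fin.last k) < ξ (Fin.init z)} := by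
        refine ⟨by simpa using ha, ?_⟩
        simp only [Fin.snoc_last, Fin.init_snoc]; exact hξpos a ha
      obtain ⟨z, hzN, hzP⟩ := mem_closure_iff_nhds.1 (hcl a (hS₀B ha)) _ (hN.mem_nhds hmemN)
      have hz0 : 0 < z (Fin.last k) := (hPB hzP).2
      have hzS : (Fin.init z : Fin k → ℝ) ∈ S₀ := by simpa using hzN.1
      exact disjoint_left.1 h (hband_mem z hzS hz0 hzN.2) hzP
  refine ⟨S₀, ξ, hS₀o, hS₀sa, hS₀ne, hS₀B, hξcont, hξpos, fun z hz h0 hξz => hTbP (hband_mem z hz h0 hξz), fun i => ?_⟩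
  exact (hC1 i _ hTb hTbP).mono fun z hz => hband_mem z hz.1 hz.2.1 hz.2.2

end Band

/-! ### Reindexing for the wing: `(u, t) ∈ ℝᵏ⁺¹`, rest `∈ ℝʲ` -/

section Reindex

variable {k : ℕ}

/-- The base coordinates `(u, y₀)` inside `ℝᵏ⁺⁽ʲ⁺¹⁾`. [cite: Pawlucki2024, Lemma 5.4, (5.4.5)] -/
def ιbase (k j : ℕ) : Fin (k + 1) → Fin (k + (j + 1)) :=
  Fin.snoc (fun i : Fin k => Fin.castAdd (j + 1) i) (Fin.natAdd k (0 : Fin (j + 1)))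

/-- The base point `(u, y₀)` of `z`. [cite: Pawlucki2024, Lemma 5.4, (5.4.5)] -/
def wbase (j : ℕ) (z : Fin (k + (j + 1)) → ℝ) : Fin (k + 1) → ℝ := z ∘ ιbase k j

/-- `wbase z = snoc (upart z) (ypart z 0)`. [cite: Pawlucki2024, Lemma 5.4] -/
theorem wbase_eq (j : ℕ) (z : Fin (k + (j + 1)) → ℝ) : wbase j z = Fin.snoc (upart (j + 1) z) (ypart (j + 1) z 0) := by
  funext i
  refine Fin.lastCases ?_ (fun l => ?_) i
  · simp [wbase, ιbase, ypart]
  · simp [wbase, ιbase, upart]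

/-- `wbase` is continuous. [folklore] -/
theorem continuous_wbase (j : ℕ) : Continuous (wbase (k := k) j) := continuous_proj _

/-- `wbase (spinePt a) = snoc a 0`. [cite: Pawlucki2024, Lemma 5.4] -/
theorem wbase_spinePt (j : ℕ) (a : Fin k → ℝ) : wbase j (spinePt (j + 1) a) = Fin.snoc a 0 := by
  rw [wbase_eq, upart_spinePt, ypart_spinePt]; rfl

/-- The wing permutation: `(v, y') ↦ z` with `upart z = init v`, `ypart z 0 = v last`, `ypart z (l+1) = y' l`.
[cite: Pawlucki2024, Lemma 5.4, (5.4.5)] -/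
def wingσ (k j : ℕ) : Fin (k + (j + 1)) → Fin (k + 1 + j) :=
  Fin.addCases (fun i : Fin k => Fin.castAdd j i.castSucc)
    (fun l' : Fin (j + 1) => Fin.cases (Fin.castAdd j (Fin.last k)) (fun l : Fin j => Fin.natAdd (k + 1) l) l')

/-- The wing assembly of `v ∈ ℝᵏ⁺¹` and `y' ∈ ℝʲ`. [cite: Pawlucki2024, Lemma 5.4, (5.4.5)] -/
def wasm (j : ℕ) (v : Fin (k + 1) → ℝ) (y' : Fin j → ℝ) : Fin (k + (j + 1)) → ℝ := (Fin.append v y') ∘ wingσ k j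

/-- `upart (wasm v y') = init v`. [cite: Pawlucki2024, Lemma 5.4] -/
@[simp] theorem upart_wasm (j : ℕ) (v : Fin (k + 1) → ℝ) (y' : Fin j → ℝ) : upart (j + 1) (wasm j v y') = Fin.init v := by
  funext i
  simp only [upart, wasm, Function.comp_apply, wingσ, Fin.addCases_left, Fin.append_left, Fin.init]

/-- `ypart (wasm v y') 0 = v last`. [cite: Pawlucki2024, Lemma 5.4] -/
@[simp] theorem ypart_wasm_zero (j : ℕ) (v : Fin (k + 1) → ℝ) (y' : Fin j → ℝ) : ypart (j + 1) (wasm j v y') 0 = v (Fin.last k) := by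
  simp only [ypart, wasm, Function.comp_apply, wingσ, Fin.addCases_right, Fin.cases_zero, Fin.append_left]

/-- `ypart (wasm v y') (l+1) = y' l`. [cite: Pawlucki2024, Lemma 5.4] -/
@[simp] theorem ypart_wasm_succ (j : ℕ) (v : Fin (k + 1) → ℝ) (y' : Fin j → ℝ) (l : Fin j) :
    ypart (j + 1) (wasm j v y') l.succ = y' l := by
  simp only [ypart, wasm, Function.comp_apply, wingσ, Fin.addCases_right, Fin.cases_succ, Fin.append_right]

/-- `wbase (wasm v y') = v`. [cite: Pawlucki2024, Lemma 5.4] -/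
@[simp] theorem wbase_wasm (j : ℕ) (v : Fin (k + 1) → ℝ) (y' : Fin j → ℝ) : wbase j (wasm j v y') = v := by
  rw [wbase_eq, upart_wasm, ypart_wasm_zero, Fin.snoc_init_self]

/-- Every point is a wing assembly of its base and its tail. [cite: Pawlucki2024, Lemma 5.4] -/
theorem wasm_wbase_tail (j : ℕ) (z : Fin (k + (j + 1)) → ℝ) : wasm j (wbase j z) (fun l => ypart (j + 1) z l.succ) = z := by
  have hu : upart (j + 1) (wasm j (wbase j z) (fun l => ypart (j + 1) z l.succ)) = upart (j + 1) z := by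
    rw [upart_wasm, wbase_eq, Fin.init_snoc]
  have hy : ypart (j + 1) (wasm j (wbase j z) (fun l => ypart (j + 1) z l.succ)) = ypart (j + 1) z := by
    funext l
    refine Fin.cases ?_ (fun l' => ?_) l
    · rw [ypart_wasm_zero, wbase_eq, Fin.snoc_last]
    · rw [ypart_wasm_succ]
  have h1 := eq_append_upart_ypart (j + 1) (wasm j (wbase j z) (fun l => ypart (j + 1) z l.succ))
  have h2 := eq_append_upart_ypart (j + 1) z
  rw [hu, hy] at h1
  exact h1.trans h2.symm

/-- The `ypart` of a wing assembly as `cons`. [cite: Pawlucki2024, Lemma 5.4] -/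
theorem ypart_wasm (j : ℕ) (v : Fin (k + 1) → ℝ) (y' : Fin j → ℝ) : ypart (j + 1) (wasm j v y') = Fin.cons (v (Fin.last k)) y' := by
  funext l
  refine Fin.cases ?_ (fun l' => ?_) l
  · rw [ypart_wasm_zero, Fin.cons_zero]
  · rw [ypart_wasm_succ, Fin.cons_succ]

end Reindex

/-! ### The squeeze in base coordinates -/

section Squeeze'

variable {k : ℕ}

/-- **The squeeze, base form**: `‖y‖ ≤ C |y₀|` whenever `dist u a < δ` and `|y₀| < δ`.
[cite: Pawlucki2024, Lemma 5.4 (proof)] -/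
theorem exists_norm_ypart_le' {Ω : Set (Fin k → ℝ)} (hΩ : IsOpen Ω) {a : Fin k → ℝ} (ha : a ∈ Ω) :
    ∀ (j : ℕ) (T : Tower k (j + 1)), Tower.Hyp Ω (j + 1) T →
      ∃ (C δ : ℝ), 0 ≤ C ∧ 0 < δ ∧ ∀ z ∈ angle Ω (j + 1) T, dist (upart (j + 1) z) a < δ → |ypart (j + 1) z 0| < δ →
        ‖ypart (j + 1) z‖ ≤ C * |ypart (j + 1) z 0|
  | 0, ⟨T, ℓ⟩, _ => by
    refine ⟨1, 1, zero_le_one, one_pos, fun z _ _ _ => ?_⟩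
    rw [norm_ypart_one, one_mul, ← ypart_last 0 z]
    rfl
  | j + 1, ⟨T, ℓ'⟩, H => by
    obtain ⟨C, δ, hC, hδ, hIH⟩ := exists_norm_ypart_le' hΩ ha j T H.1
    obtain ⟨Cl, Rl, hCl, hRl, hlev⟩ := exists_level_bound hΩ ha j T ℓ' H
    set δ' := min δ (Rl / (1 + C)) with hδ'
    have hδ'pos : 0 < δ' := lt_min hδ (div_pos hRl (by linarith))
    refine ⟨(1 + Cl) * C, δ', by positivity, hδ'pos, fun z hz hdu hy0 => ?_⟩
    have hw : Fin.init z ∈ angle Ω (j + 1) T := hz.1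
    have hy : ypart (j + 1 + 1) z = Fin.snoc (ypart (j + 1) (Fin.init z)) (z (Fin.last (k + (j + 1)))) := ypart_succ_eq_snoc (j + 1) z
    have hu : upart (j + 1) (Fin.init z) = upart (j + 1 + 1) z := upart_init (j + 1) z
    rw [← ypart_init_zero j z] at hy0 ⊢
    rw [hy, norm_snoc_max]
    have hIHw := hIH _ hw (by rw [hu]; exact hdu.trans_le (min_le_left _ _)) (hy0.trans_le (min_le_left _ _))
    by_cases hyw : ypart (j + 1) (Fin.init z) = 0
    · have ht : z (Fin.last (k + (j + 1))) = 0 := last_eq_zero_of_ypart_init H (Nat.succ_pos j) hz hyw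
      rw [hyw, ht, norm_zero, abs_zero, max_self]; simp
    · -- the lower point is within `Rl` of the vertex
      have hdw : dist (Fin.init z) (spinePt (j + 1) a) < Rl := by
        rw [dist_spinePt_eq, hu]
        refine max_lt (hdu.trans_le ((min_le_right _ _).trans (div_le_self hRl.le (by linarith)))) ?_
        calc ‖ypart (j + 1) (Fin.init z)‖ ≤ C * |ypart (j + 1) (Fin.init z) 0| := hIHw
          _ < C * δ' + δ' := by nlinarith [abs_nonneg (ypart (j + 1) (Fin.init z) 0)]
          _ = (1 + C) * δ' := by ring
          _ ≤ (1 + C) * (Rl / (1 + C)) := mul_le_mul_of_nonneg_left (min_le_right _ _) (by linarith)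
          _ = Rl := by field_simp
      obtain ⟨hφ, hψ⟩ := hlev _ hw hdw hyw
      have ht : |z (Fin.last (k + (j + 1)))| ≤ Cl * ‖ypart (j + 1) (Fin.init z)‖ :=
        (abs_le_max_abs_abs hz.2.1 hz.2.2).trans (max_le hφ hψ)
      have h1 : max ‖ypart (j + 1) (Fin.init z)‖ |z (Fin.last (k + (j + 1)))| ≤ (1 + Cl) * ‖ypart (j + 1) (Fin.init z)‖ := by
        refine max_le ?_ (ht.trans ?_)
        · exact le_mul_of_one_le_left (norm_nonneg _) (le_add_of_nonneg_right hCl)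
        · rw [add_mul, one_mul]; exact le_add_of_nonneg_left (norm_nonneg _)
      calc max ‖ypart (j + 1) (Fin.init z)‖ |z (Fin.last (k + (j + 1)))| ≤ (1 + Cl) * ‖ypart (j + 1) (Fin.init z)‖ := h1
        _ ≤ (1 + Cl) * (C * |ypart (j + 1) (Fin.init z) 0|) := mul_le_mul_of_nonneg_left hIHw (by positivity)
        _ = (1 + Cl) * C * |ypart (j + 1) (Fin.init z) 0| := by ring

/-- **Off the spine the first fibre coordinate is positive.** [cite: Pawlucki2024, Lemma 5.4] -/
theorem ypart_zero_pos_of_ne {Ω : Set (Fin k → ℝ)} :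
    ∀ (j : ℕ) (T : Tower k (j + 1)), Tower.Hyp Ω (j + 1) T → ∀ {z : Fin (k + (j + 1)) → ℝ},
      z ∈ angle Ω (j + 1) T → ypart (j + 1) z ≠ 0 → 0 < ypart (j + 1) z 0
  | 0, ⟨T, ℓ⟩, H, z, hz, hne => by
    obtain ⟨-, -, -, hpinch, -⟩ := H
    have h0 : ℓ.φ (Fin.init z) ≤ z (Fin.last (k + 0)) := hz.2.1
    rw [(hpinch _ hz.1 (ypart_zero _)).1] at h0
    have hlast : ypart 1 z 0 = z (Fin.last (k + 0)) := by rw [← ypart_last 0 z]; rfl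
    rw [hlast]
    rcases eq_or_lt_of_le h0 with h | h
    · exfalso; apply hne
      funext i
      have hi : i = 0 := Fin.ext (by have := i.isLt; omega)
      rw [hi, hlast]; exact h.symm
    · exact h
  | j + 1, ⟨T, ℓ'⟩, H, z, hz, hne => by
    have hyw : ypart (j + 1) (Fin.init z) ≠ 0 := ypart_init_ne_zero H (Nat.succ_pos j) hz hne
    rw [← ypart_init_zero j z]
    exact ypart_zero_pos_of_ne j T H.1 hz.1 hyw

end Squeeze'

/-! ### Step (W1): Baire uniformization of the failure of the tangential limit -/

section W1

variable {k : ℕ}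

/-- `spinePt` is continuous. [folklore] -/
theorem continuous_spinePt (j : ℕ) : Continuous (spinePt (k := k) j) := by
  refine continuous_pi fun i => ?_
  refine Fin.addCases (fun l => ?_) (fun l => ?_) i
  · simp only [spinePt, Fin.append_left]; exact continuous_apply _
  · simp only [spinePt, Fin.append_right]; exact continuous_const

/-- **(W1)** On a ball of vertex points where the tangential derivative `h` does not tend to `0`,
some smaller ball and some `N` have every vertex point in the closure of `{|h| ≥ 1/(N+1)} ∩ U`.
[cite: Pawlucki2024, Lemma 5.4 (proof, (5.4.3)⇒"there exists a nonempty open subset G and ε > 0")] -/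
theorem exists_uniform_level {Ω : Set (Fin k → ℝ)} (j : ℕ) (T : Tower k (j + 1)) {U : Set (Fin (k + (j + 1)) → ℝ)}
    (hnear : ∀ a ∈ Ω, ∃ R > 0, ∀ z ∈ pAngle Ω (j + 1) T, dist z (spinePt (j + 1) a) < R → z ∈ U)
    (h : (Fin (k + (j + 1)) → ℝ) → ℝ) {a₀ : Fin k → ℝ} {r₀ : ℝ} (hr₀ : 0 < r₀)
    (hbad : ball a₀ r₀ ⊆ {a | a ∈ Ω ∧ ¬ Tendsto h (𝓝[pAngle Ω (j + 1) T] (spinePt (j + 1) a)) (𝓝 0)}) :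
    ∃ (N : ℕ) (a₁ : Fin k → ℝ) (r₁ : ℝ), 0 < r₁ ∧ ball a₁ r₁ ⊆ ball a₀ r₀ ∧
      ∀ a ∈ ball a₁ r₁, spinePt (j + 1) a ∈ closure {z | z ∈ pAngle Ω (j + 1) T ∧ z ∈ U ∧ (1 : ℝ) / (N + 1) ≤ |h z|} := by
  set X : ℕ → Set (Fin (k + (j + 1)) → ℝ) := fun N => {z | z ∈ pAngle Ω (j + 1) T ∧ z ∈ U ∧ (1 : ℝ) / (N + 1) ≤ |h z|} with hX
  set F : ℕ → Set (Fin k → ℝ) := fun N => {a | spinePt (j + 1) a ∈ closure (X N)} with hF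
  have hFc : ∀ N, IsClosed (F N) := fun N => isClosed_closure.preimage (continuous_spinePt (j + 1))
  have hcov : ball a₀ r₀ ⊆ ⋃ N, F N := by
    intro a ha
    obtain ⟨haΩ, hnt⟩ := hbad ha
    rw [Metric.tendsto_nhds] at hnt
    push Not at hnt
    obtain ⟨ε, hε, hfreq⟩ := hnt
    obtain ⟨N, hN⟩ := exists_nat_one_div_lt hε
    obtain ⟨R, hR, hRU⟩ := hnear a haΩ
    have hev : ∀ᶠ z in 𝓝[pAngle Ω (j + 1) T] (spinePt (j + 1) a), z ∈ pAngle Ω (j + 1) T ∧ z ∈ U := by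
      have hb : ∀ᶠ z in 𝓝[pAngle Ω (j + 1) T] (spinePt (j + 1) a), dist z (spinePt (j + 1) a) < R :=
        mem_nhdsWithin_of_mem_nhds (ball_mem_nhds _ hR)
      filter_upwards [hb, self_mem_nhdsWithin] with z hz hz'
      exact ⟨hz', hRU z hz' hz⟩
    have hfr : ∃ᶠ z in 𝓝[pAngle Ω (j + 1) T] (spinePt (j + 1) a), z ∈ X N := by
      have h2 := hfreq.and_eventually hev
      refine h2.mono fun z hz => ⟨hz.2.1, hz.2.2, ?_⟩
      have h3 : ε ≤ dist (h z) 0 := hz.1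
      rw [Real.dist_eq, sub_zero] at h3
      exact hN.le.trans h3
    exact mem_iUnion.2 ⟨N, mem_closure_iff_frequently.2 (hfr.filter_mono nhdsWithin_le_nhds)⟩
  obtain ⟨N, a₁, r₁, hr₁, hsub⟩ := exists_ball_subset_of_iUnion_closed isOpen_ball ⟨a₀, mem_ball_self hr₀⟩ F hFc hcov
  exact ⟨N, a₁, r₁, hr₁, fun a ha => (hsub ha).1, fun a ha => (hsub ha).2⟩

end W1

/-! ### Step (W4a): one-variable boundedness of the derivative from a linear squeeze -/

section W4a

open Literature.NumberTheory.Transcendental.SemialgebraicMonotonicity (eventually_nhdsGT_mem_or)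

/-- **(W4a)** A semialgebraic continuous `g` on `(0, δ)` which is the derivative of a function `φc`
with `|φc t| ≤ C t` is bounded near `0⁺`: otherwise `|g| → ∞` with constant sign near `0⁺` (germs of
semialgebraic subsets of the line are constant; intermediate values) and the mean value theorem
contradicts the squeeze. [cite: Pawlucki2024, Lemma 5.4 (proof, (5.4.6))] -/
theorem exists_bound_near_zero {δ C : ℝ} (hδ : 0 < δ) {g φc : ℝ → ℝ}
    (hder : ∀ t ∈ Ioo 0 δ, HasDerivAt φc (g t) t) (hgc : ContinuousOn g (Ioo 0 δ))
    (hgs : IsSemialgebraicFunOn ℝ {z : Fin 1 → ℝ | z 0 ∈ Ioo 0 δ} (fun z => g (z 0)))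
    (hsq : ∀ t ∈ Ioo 0 δ, |φc t| ≤ C * t) :
    ∃ (M η : ℝ), 0 < η ∧ ∀ t ∈ Ioo 0 η, |g t| ≤ M := by
  -- the sub-level sets and their germs at `0⁺`
  have hA : ∀ M : ℝ, IsSemialgebraic ℝ {z : Fin 1 → ℝ | z 0 ∈ {t | t ∈ Ioo 0 δ ∧ |g t| ≤ M}} := by
    intro M
    have hO := sa_graph_aux hδ
    have h := LadderData.sa_sep_lt (isSemialgebraicFunOn_const' hO M) hgs.abs
    have heq : {z : Fin 1 → ℝ | z 0 ∈ {t | t ∈ Ioo 0 δ ∧ |g t| ≤ M}} =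
        {z : Fin 1 → ℝ | z 0 ∈ Ioo 0 δ} \ {z | z ∈ {z : Fin 1 → ℝ | z 0 ∈ Ioo 0 δ} ∧ M < |g (z 0)|} := by
      ext z; simp only [mem_setOf_eq, Set.mem_sdiff, not_and, not_lt]
      exact ⟨fun ⟨h1, h2⟩ => ⟨h1, fun _ => h2⟩, fun ⟨h1, h2⟩ => ⟨h1, h2 h1⟩⟩
    rw [heq]; exact hO.diff h
  by_cases hgood : ∃ M : ℕ, ∀ᶠ t in 𝓝[>] (0 : ℝ), t ∈ {t | t ∈ Ioo 0 δ ∧ |g t| ≤ M}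
  · obtain ⟨M, hM⟩ := hgood
    obtain ⟨η, hη, hsub⟩ := mem_nhdsGT_iff_exists_Ioo_subset.1 hM
    exact ⟨M, η, hη, fun t ht => (hsub ht).2⟩
  · exfalso
    push Not at hgood
    set M₀ : ℕ := ⌈C⌉₊ + 1 with hM₀
    have hM₀C : C < M₀ := by
      have := Nat.le_ceil C; rw [hM₀]; push_cast; linarith
    have hev : ∀ᶠ t in 𝓝[>] (0 : ℝ), t ∉ {t | t ∈ Ioo 0 δ ∧ |g t| ≤ M₀} := by
      rcases eventually_nhdsGT_mem_or (hA M₀) 0 with h | h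
      · exact (((hgood M₀).and_eventually h).exists.elim fun t ht => ht.1 ht.2).elim
      · exact h
    obtain ⟨η₀, hη₀, hsub⟩ := mem_nhdsGT_iff_exists_Ioo_subset.1 hev
    set η := min η₀ δ with hη
    have hηpos : 0 < η := lt_min hη₀ hδ
    have hbig : ∀ t ∈ Ioo 0 η, (M₀ : ℝ) < |g t| := by
      intro t ht
      have h := hsub ⟨ht.1, ht.2.trans_le (min_le_left _ _)⟩
      simp only [mem_setOf_eq, not_and, not_le] at h
      exact h ⟨ht.1, ht.2.trans_le (min_le_right _ _)⟩
    have hM₀pos : (0 : ℝ) < M₀ := by rw [hM₀]; positivity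
    have hne : ∀ t ∈ Ioo 0 η, g t ≠ 0 := fun t ht h0 => by
      have := hbig t ht; rw [h0, abs_zero] at this; linarith
    have hgc' : ContinuousOn g (Ioo 0 η) := hgc.mono (Ioo_subset_Ioo_right (min_le_right _ _))
    -- `φc t - φc s` has the sign of `g` and size `≥ M₀ (t - s)`
    have hMVT : ∀ s t, 0 < s → s < t → t < η → ∃ c ∈ Ioo s t, φc t - φc s = g c * (t - s) := by
      intro s t hs hst htη
      have hIcc : Icc s t ⊆ Ioo 0 δ := fun x hx => ⟨hs.trans_le hx.1, hx.2.trans_lt (htη.trans_le (min_le_right _ _))⟩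
      obtain ⟨c, hc, hcslope⟩ := exists_hasDerivAt_eq_slope φc g hst
        (fun x hx => (hder x (hIcc hx)).continuousAt.continuousWithinAt) (fun x hx => hder x (hIcc ⟨hx.1.le, hx.2.le⟩))
      refine ⟨c, hc, ?_⟩
      rw [hcslope, div_mul_cancel₀ _ (sub_ne_zero.2 hst.ne')]
    have hφ0 : Tendsto φc (𝓝[>] 0) (𝓝 0) := by
      have hb : ∀ᶠ t in 𝓝[>] (0 : ℝ), ‖φc t‖ ≤ C * t := by
        filter_upwards [Ioo_mem_nhdsGT hδ] with t ht
        rw [Real.norm_eq_abs]; exact hsq t ht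
      have hl : Tendsto (fun t : ℝ => C * t) (𝓝[>] (0 : ℝ)) (𝓝 0) := by
        have h : Tendsto (fun t : ℝ => C * t) (𝓝 (0 : ℝ)) (𝓝 (C * 0)) := (continuous_const.mul continuous_id).tendsto 0
        rw [mul_zero] at h; exact h.mono_left nhdsWithin_le_nhds
      exact squeeze_zero_norm' hb hl
    -- a point `t₀ ∈ (0, η)` and the contradiction
    set t₀ := η / 2 with ht₀
    have ht₀mem : t₀ ∈ Ioo 0 η := ⟨half_pos hηpos, half_lt_self hηpos⟩
    have hsq₀ := hsq t₀ ⟨ht₀mem.1, ht₀mem.2.trans_le (min_le_right _ _)⟩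
    rcases forall_pos_or_forall_neg_of_continuousOn hgc' hne with hpos | hneg
    · -- `g > M₀` on `(0, η)`: `φc t₀ ≥ M₀ t₀`
      have hlow : ∀ s ∈ Ioo 0 t₀, (M₀ : ℝ) * (t₀ - s) ≤ φc t₀ - φc s := by
        intro s hs
        obtain ⟨c, hc, heq⟩ := hMVT s t₀ hs.1 hs.2 ht₀mem.2
        have hgc : (M₀ : ℝ) < g c := by
          have h1 := hbig c ⟨hs.1.trans hc.1, hc.2.trans ht₀mem.2⟩
          have h2 := hpos c ⟨hs.1.trans hc.1, hc.2.trans ht₀mem.2⟩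
          rwa [abs_of_pos h2] at h1
        rw [heq]; nlinarith [hs.2]
      have hlim : (M₀ : ℝ) * t₀ ≤ φc t₀ := by
        have h1 : Tendsto (fun s => (M₀ : ℝ) * (t₀ - s)) (𝓝[>] 0) (𝓝 ((M₀ : ℝ) * (t₀ - 0))) :=
          ((continuous_const.mul (continuous_const.sub continuous_id)).tendsto 0).mono_left nhdsWithin_le_nhds
        rw [sub_zero] at h1
        have h2 : Tendsto (fun s => φc t₀ - φc s) (𝓝[>] 0) (𝓝 (φc t₀ - 0)) := tendsto_const_nhds.sub hφ0
        rw [sub_zero] at h2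
        exact le_of_tendsto_of_tendsto h1 h2 (by filter_upwards [Ioo_mem_nhdsGT ht₀mem.1] with s hs using hlow s hs)
      have : (M₀ : ℝ) * t₀ ≤ C * t₀ := hlim.trans ((le_abs_self _).trans hsq₀)
      nlinarith [ht₀mem.1]
    · have hlow : ∀ s ∈ Ioo 0 t₀, φc t₀ - φc s ≤ -((M₀ : ℝ) * (t₀ - s)) := by
        intro s hs
        obtain ⟨c, hc, heq⟩ := hMVT s t₀ hs.1 hs.2 ht₀mem.2
        have hgc : g c < -(M₀ : ℝ) := by
          have h1 := hbig c ⟨hs.1.trans hc.1, hc.2.trans ht₀mem.2⟩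
          have h2 := hneg c ⟨hs.1.trans hc.1, hc.2.trans ht₀mem.2⟩
          rw [abs_of_neg h2] at h1; linarith
        rw [heq]; nlinarith [hs.2]
      have hlim : φc t₀ ≤ -((M₀ : ℝ) * t₀) := by
        have h1 : Tendsto (fun s => -((M₀ : ℝ) * (t₀ - s))) (𝓝[>] 0) (𝓝 (-((M₀ : ℝ) * (t₀ - 0)))) :=
          ((continuous_const.mul (continuous_const.sub continuous_id)).neg.tendsto 0).mono_left nhdsWithin_le_nhds
        rw [sub_zero] at h1
        have h2 : Tendsto (fun s => φc t₀ - φc s) (𝓝[>] 0) (𝓝 (φc t₀ - 0)) := tendsto_const_nhds.sub hφ0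
        rw [sub_zero] at h2
        exact le_of_tendsto_of_tendsto h2 h1 (by filter_upwards [Ioo_mem_nhdsGT ht₀mem.1] with s hs using hlow s hs)
      have : (M₀ : ℝ) * t₀ ≤ C * t₀ := by have := (neg_abs_le (φc t₀)).trans hlim |> fun h => h; linarith [neg_abs_le (φc t₀), hsq₀]
      nlinarith [ht₀mem.1]
where
  /-- the open interval as a semialgebraic subset of `ℝ¹` -/
  sa_graph_aux {δ : ℝ} (_hδ : 0 < δ) : IsSemialgebraic ℝ {z : Fin 1 → ℝ | z 0 ∈ Ioo 0 δ} :=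
    (Literature.NumberTheory.Transcendental.SemialgebraicMonotonicity.sa_const_lt (0 : Fin 1) 0).inter
      (Literature.NumberTheory.Transcendental.SemialgebraicMonotonicity.sa_lt_const (0 : Fin 1) δ)

end W4a

/-! ### Step (W4b): Baire uniformization of pointwise bounds near the bottom -/

section W4b

variable {m : ℕ}

/-- **(W4b)** Finitely many functions continuous on a half-box, each bounded near `t = 0⁺` along every
vertical line, are uniformly bounded on `(0, δ/2]` over some smaller ball of base points (Baire category).
[folklore] -/
theorem exists_uniform_bound {ι : Type} [Fintype ι] {b : Fin m → ℝ} {ρ δ : ℝ} (hρ : 0 < ρ) (hδ : 0 < δ)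
    (g : ι → (Fin (m + 1) → ℝ) → ℝ) (hg : ∀ l, ContinuousOn (g l) (halfBox (ball b ρ) δ))
    (hpt : ∀ u ∈ ball b ρ, ∀ l, ∃ (M η : ℝ), 0 < η ∧ ∀ t ∈ Ioo 0 η, |g l (Fin.snoc u t)| ≤ M) :
    ∃ (b' : Fin m → ℝ) (ρ' M : ℝ), 0 < ρ' ∧ ball b' ρ' ⊆ ball b ρ ∧
      ∀ u ∈ ball b' ρ', ∀ t ∈ Ioc 0 (δ / 2), ∀ l, |g l (Fin.snoc u t)| ≤ M := by
  classical
  set F : ℕ → Set (Fin m → ℝ) := fun M => {u | u ∉ ball b ρ ∨ ∀ l, ∀ t ∈ Ioc 0 (δ / 2), |g l (Fin.snoc u t)| ≤ M} with hF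
  -- slices are continuous on the ball
  have hslice : ∀ l, ∀ t ∈ Ioc 0 (δ / 2), ContinuousOn (fun u => g l (Fin.snoc u t)) (ball b ρ) := by
    intro l t ht
    refine (hg l).comp (continuous_snoc_pair.comp (continuous_id.prodMk continuous_const)).continuousOn fun u hu => ?_
    exact snoc_mem_halfBox.2 ⟨hu, ht.1, ht.2.trans_lt (half_lt_self hδ)⟩
  have hFc : ∀ M, IsClosed (F M) := by
    intro M
    have hopen : IsOpen {u | u ∈ ball b ρ ∧ ∃ l, ∃ t ∈ Ioc 0 (δ / 2), (M : ℝ) < |g l (Fin.snoc u t)|} := by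
      have h : {u | u ∈ ball b ρ ∧ ∃ l, ∃ t ∈ Ioc 0 (δ / 2), (M : ℝ) < |g l (Fin.snoc u t)|} =
          ⋃ l, ⋃ t ∈ Ioc 0 (δ / 2), {u | u ∈ ball b ρ ∧ (M : ℝ) < |g l (Fin.snoc u t)|} := by
        ext u; simp only [mem_setOf_eq, mem_iUnion, exists_prop]
        constructor
        · rintro ⟨hu, l, t, ht, h⟩; exact ⟨l, t, ht, hu, h⟩
        · rintro ⟨l, t, ht, hu, h⟩; exact ⟨hu, l, t, ht, h⟩
      rw [h]
      refine isOpen_iUnion fun l => isOpen_biUnion fun t ht => ?_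
      exact LadderData.isOpen_sep_lt isOpen_ball continuousOn_const ((hslice l t ht).abs)
    have hcompl : (F M)ᶜ = {u | u ∈ ball b ρ ∧ ∃ l, ∃ t ∈ Ioc 0 (δ / 2), (M : ℝ) < |g l (Fin.snoc u t)|} := by
      ext u
      simp only [hF, mem_compl_iff, mem_setOf_eq, not_or, not_forall, not_le, not_not, exists_prop]
    rw [← isOpen_compl_iff, hcompl]; exact hopen
  have hcov : ball b ρ ⊆ ⋃ M, F M := by
    intro u hu
    -- a bound for each `l` on `(0, δ/2]`
    have hbd : ∀ l, ∃ Ml : ℝ, ∀ t ∈ Ioc 0 (δ / 2), |g l (Fin.snoc u t)| ≤ Ml := by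
      intro l
      obtain ⟨M, η, hη, hM⟩ := hpt u hu l
      set η' := min η (δ / 2) with hη'
      have hη'pos : 0 < η' := lt_min hη (half_pos hδ)
      have hcont : ContinuousOn (fun t => |g l (Fin.snoc u t)|) (Icc (η' / 2) (δ / 2)) := by
        refine ((hg l).comp (continuous_snoc_pair.comp (continuous_const.prodMk continuous_id)).continuousOn fun t ht => ?_).abs
        exact snoc_mem_halfBox.2 ⟨hu, (half_pos hη'pos).trans_le ht.1, ht.2.trans_lt (half_lt_self hδ)⟩
      obtain ⟨M', hM'⟩ := isCompact_Icc.exists_bound_of_continuousOn hcont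
      refine ⟨max M M', fun t ht => ?_⟩
      by_cases hts : t < η'
      · exact (hM t ⟨ht.1, hts.trans_le (min_le_left _ _)⟩).trans (le_max_left _ _)
      · have hmem : t ∈ Icc (η' / 2) (δ / 2) := ⟨(half_le_self hη'pos.le).trans (not_lt.1 hts), ht.2⟩
        have h := hM' t hmem
        rw [Real.norm_eq_abs, abs_abs] at h
        exact h.trans (le_max_right _ _)
    choose Ml hMl using hbd
    obtain ⟨M, hM⟩ := exists_nat_ge (∑ l, |Ml l|)
    refine mem_iUnion.2 ⟨M, Or.inr fun l t ht => (hMl l t ht).trans ?_⟩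
    exact (le_abs_self _).trans ((Finset.single_le_sum (f := fun l => |Ml l|) (fun l _ => abs_nonneg _) (Finset.mem_univ l)).trans hM)
  obtain ⟨M, b', ρ', hρ', hsub⟩ := exists_ball_subset_of_iUnion_closed isOpen_ball ⟨b, mem_ball_self hρ⟩ F hFc hcov
  refine ⟨b', ρ', M, hρ', fun u hu => (hsub hu).1, fun u hu t ht l => ?_⟩
  rcases (hsub hu).2 with h | h
  · exact absurd (hsub hu).1 h
  · exact h l t ht

end W4b

/-! ### The wing map and its derivative -/

section WingMap

variable {k : ℕ}

/-- The derivative of the wing map `v ↦ wasm v (fs v)`. [cite: Pawlucki2024, Lemma 5.4, (5.4.5)] -/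
def wingCLM (k j : ℕ) (D : Fin j → (Fin (k + 1) → ℝ) →L[ℝ] ℝ) : (Fin (k + 1) → ℝ) →L[ℝ] (Fin (k + (j + 1)) → ℝ) :=
  ContinuousLinearMap.pi fun idx : Fin (k + (j + 1)) =>
    Fin.addCases (motive := fun _ => (Fin (k + 1) → ℝ) →L[ℝ] ℝ)
      (fun i'' : Fin k => ContinuousLinearMap.proj (R := ℝ) (φ := fun _ : Fin (k + 1) => ℝ) i''.castSucc)
      (fun l' : Fin (j + 1) => Fin.cases (ContinuousLinearMap.proj (R := ℝ) (φ := fun _ : Fin (k + 1) => ℝ) (Fin.last k))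
        (fun l : Fin j => D l) l') idx

/-- Coordinates of `wasm`. [cite: Pawlucki2024, Lemma 5.4] -/
theorem wasm_apply_castAdd (j : ℕ) (v : Fin (k + 1) → ℝ) (y' : Fin j → ℝ) (i'' : Fin k) :
    wasm j v y' (Fin.castAdd (j + 1) i'') = v i''.castSucc := by
  simp only [wasm, Function.comp_apply, wingσ, Fin.addCases_left, Fin.append_left]

/-- Coordinates of `wasm`. [cite: Pawlucki2024, Lemma 5.4] -/
theorem wasm_apply_natAdd_zero (j : ℕ) (v : Fin (k + 1) → ℝ) (y' : Fin j → ℝ) :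
    wasm j v y' (Fin.natAdd k (0 : Fin (j + 1))) = v (Fin.last k) := by
  simp only [wasm, Function.comp_apply, wingσ, Fin.addCases_right, Fin.cases_zero, Fin.append_left]

/-- Coordinates of `wasm`. [cite: Pawlucki2024, Lemma 5.4] -/
theorem wasm_apply_natAdd_succ (j : ℕ) (v : Fin (k + 1) → ℝ) (y' : Fin j → ℝ) (l : Fin j) :
    wasm j v y' (Fin.natAdd k l.succ) = y' l := by
  simp only [wasm, Function.comp_apply, wingσ, Fin.addCases_right, Fin.cases_succ, Fin.append_right]

/-- `wingCLM D e = wasm e (D · e)`. [cite: Pawlucki2024, Lemma 5.4] -/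
theorem wingCLM_apply (j : ℕ) (D : Fin j → (Fin (k + 1) → ℝ) →L[ℝ] ℝ) (e : Fin (k + 1) → ℝ) :
    wingCLM k j D e = wasm j e (fun l => D l e) := by
  funext idx
  refine Fin.addCases (fun i'' => ?_) (fun l' => ?_) idx
  · rw [wasm_apply_castAdd]; simp [wingCLM]
  · refine Fin.cases ?_ (fun l => ?_) l'
    · rw [wasm_apply_natAdd_zero]; simp [wingCLM]
    · rw [wasm_apply_natAdd_succ]; simp [wingCLM]

/-- **The derivative of the wing map.** [cite: Pawlucki2024, Lemma 5.4, (5.4.5)] -/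
theorem hasFDerivAt_wingMap (j : ℕ) {fs : (Fin (k + 1) → ℝ) → (Fin j → ℝ)} {v : Fin (k + 1) → ℝ}
    {D : Fin j → (Fin (k + 1) → ℝ) →L[ℝ] ℝ} (hfs : ∀ l, HasFDerivAt (fun v => fs v l) (D l) v) :
    HasFDerivAt (fun v => wasm j v (fs v)) (wingCLM k j D) v := by
  rw [hasFDerivAt_pi']
  intro idx
  refine Fin.addCases (fun i'' => ?_) (fun l' => ?_) idx
  · have h : (fun v => wasm j v (fs v) (Fin.castAdd (j + 1) i'')) = fun v => v i''.castSucc := funext fun v => wasm_apply_castAdd j v _ i''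
    rw [h]
    refine ((ContinuousLinearMap.proj (R := ℝ) (φ := fun _ : Fin (k + 1) => ℝ) i''.castSucc).hasFDerivAt (x := v)).congr_fderiv ?_
    ext e; simp [wingCLM]
  · refine Fin.cases ?_ (fun l => ?_) l'
    · have h : (fun v => wasm j v (fs v) (Fin.natAdd k (0 : Fin (j + 1)))) = fun v => v (Fin.last k) := funext fun v => wasm_apply_natAdd_zero j v _
      rw [h]
      refine ((ContinuousLinearMap.proj (R := ℝ) (φ := fun _ : Fin (k + 1) => ℝ) (Fin.last k)).hasFDerivAt (x := v)).congr_fderiv ?_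
      ext e; simp [wingCLM]
    · have h : (fun v => wasm j v (fs v) (Fin.natAdd k l.succ)) = fun v => fs v l := funext fun v => wasm_apply_natAdd_succ j v _ l
      rw [h]
      refine (hfs l).congr_fderiv ?_
      ext e; simp [wingCLM]

/-- `wasm (e_last) c = Σ (cons 1 c)ᵢ e_{natAdd i}` (a pure fibre vector). [cite: Pawlucki2024, Lemma 5.4] -/
theorem wasm_single_last (j : ℕ) (c : Fin j → ℝ) :
    wasm j (Pi.single (Fin.last k) (1 : ℝ)) c = ∑ i' : Fin (j + 1), (Fin.cons 1 c : Fin (j + 1) → ℝ) i' • (Pi.single (Fin.natAdd k i') (1 : ℝ) : Fin (k + (j + 1)) → ℝ) := by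
  rw [← append_zero_eq_sum, eq_append_upart_ypart (j + 1) (wasm j _ c), upart_wasm, ypart_wasm]
  congr 1
  · funext i; simp [Fin.init, (Fin.castSucc_lt_last i).ne]
  · simp

/-- `append` of a `single` base vector with `0` fibre. [folklore] -/
theorem append_single_zero (j : ℕ) (i : Fin k) :
    (Fin.append (Pi.single i (1 : ℝ)) (0 : Fin (j + 1) → ℝ) : Fin (k + (j + 1)) → ℝ) = Pi.single (Fin.castAdd (j + 1) i) 1 := by
  funext idx
  refine Fin.addCases (fun l => ?_) (fun l => ?_) idx
  · rw [Fin.append_left]; simp [Pi.single_apply, Fin.ext_iff]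
  · rw [Fin.append_right]
    have : (Fin.natAdd k l : Fin (k + (j + 1))) ≠ Fin.castAdd (j + 1) i := by
      intro h; have := congrArg Fin.val h; simp at this; omega
    simp [this]

/-- `wasm (e_i) c = e_{castAdd i} + Σ c_l e_{natAdd (l+1)}` for a tangential direction. [cite: Pawlucki2024, Lemma 5.4] -/
theorem wasm_single_castSucc (j : ℕ) (i : Fin k) (c : Fin j → ℝ) :
    wasm j (Pi.single i.castSucc (1 : ℝ)) c = (Pi.single (Fin.castAdd (j + 1) i) (1 : ℝ) : Fin (k + (j + 1)) → ℝ) +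
      ∑ l : Fin j, c l • (Pi.single (Fin.natAdd k l.succ) (1 : ℝ) : Fin (k + (j + 1)) → ℝ) := by
  have hu : upart (j + 1) (wasm j (Pi.single i.castSucc (1 : ℝ)) c) = Pi.single i 1 := by
    rw [upart_wasm]; funext i'; simp [Fin.init, Pi.single_apply, Fin.castSucc_inj]
  have hy : ypart (j + 1) (wasm j (Pi.single i.castSucc (1 : ℝ)) c) = Fin.cons 0 c := by
    rw [ypart_wasm]; congr 1; simp [(Fin.castSucc_lt_last i).ne]
  rw [eq_append_upart_ypart (j + 1) (wasm j _ c), hu, hy]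
  have hsplit : (Fin.append (Pi.single i (1 : ℝ)) (Fin.cons 0 c : Fin (j + 1) → ℝ) : Fin (k + (j + 1)) → ℝ) =
      Fin.append (Pi.single i (1 : ℝ)) (0 : Fin (j + 1) → ℝ) + Fin.append (0 : Fin k → ℝ) (Fin.cons 0 c : Fin (j + 1) → ℝ) := by
    funext idx
    refine Fin.addCases (fun l => ?_) (fun l => ?_) idx <;> simp
  rw [hsplit, append_single_zero, append_zero_eq_sum, Fin.sum_univ_succ]
  simp

end WingMap

/-! ### The main theorem: tangential derivatives tend to `0` at generic vertex points -/

section Main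

variable {k : ℕ}

open Literature.NumberTheory.Transcendental (IsSemialgebraicFunOn.comp_isSemialgebraicMapOn_holds)

/-- A point in the closure of `s` lying in an open `O` is in the closure of `s ∩ O`. [folklore] -/
theorem mem_closure_inter_of_isOpen {X : Type*} [TopologicalSpace X] {s O : Set X} {x : X}
    (hx : x ∈ closure s) (hO : IsOpen O) (hxO : x ∈ O) : x ∈ closure (s ∩ O) := by
  rw [mem_closure_iff_nhds] at hx ⊢
  intro t ht
  obtain ⟨y, hyt, hys⟩ := hx (t ∩ O) (inter_mem ht (hO.mem_nhds hxO))
  exact ⟨y, hyt.1, hys, hyt.2⟩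

/-- `upart` is continuous. [folklore] -/
theorem continuous_upart (j : ℕ) : Continuous (upart (k := k) j) := continuous_pi fun _ => continuous_apply _

/-- Membership in a half-box. [cite: Pawlucki2024, Thm 5.3] -/
theorem mem_halfBox_iff' {m : ℕ} {G : Set (Fin m → ℝ)} {η : ℝ} (z : Fin (m + 1) → ℝ) :
    z ∈ halfBox G η ↔ Fin.init z ∈ G ∧ 0 < z (Fin.last m) ∧ z (Fin.last m) < η := Iff.rfl

/-- `upart z = z ∘ castAdd`. [folklore] -/
theorem upart_eq_comp (j : ℕ) (z : Fin (k + j) → ℝ) : upart j z = z ∘ Fin.castAdd j := rfl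

/-- The punctured angle is semialgebraic when the angle is. [cite: Pawlucki2024, Lemma 5.4] -/
theorem isSemialgebraic_pAngle {Ω : Set (Fin k → ℝ)} (j : ℕ) (T : Tower k j) (hAs : IsSemialgebraic ℝ (angle Ω j T)) :
    IsSemialgebraic ℝ (pAngle Ω j T) := by
  have h0 : IsSemialgebraic ℝ {z : Fin (k + j) → ℝ | ypart j z = 0} := by
    have h : {z : Fin (k + j) → ℝ | ypart j z = 0} = ⋂ i : Fin j, {z | z (Fin.natAdd k i) = 0} := by
      ext z; simp only [mem_setOf_eq, mem_iInter, funext_iff, ypart, Pi.zero_apply]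
    rw [h]
    have h' : (⋂ i : Fin j, {z : Fin (k + j) → ℝ | z (Fin.natAdd k i) = 0}) = ⋂ i ∈ (Finset.univ : Finset (Fin j)), {z : Fin (k + j) → ℝ | z (Fin.natAdd k i) = 0} := by
      simp
    rw [h']
    exact IsSemialgebraic.biInter _ _ fun i _ => Literature.NumberTheory.Transcendental.SemialgebraicMonotonicity.sa_eq_const (Fin.natAdd k i) 0
  exact hAs.diff h0 |> fun h => by
    have heq : pAngle Ω j T = angle Ω j T \ {z | ypart j z = 0} := by ext z; simp [pAngle]
    rw [heq]; exact h


/-- **Tangential derivatives vanish in the limit at good bottom points** (from Theorem 5.3): if the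
boundary extension `bdExt φ g` is `C¹` on the closed half-box with bottom derivative
`D(g ∘ init) + λ dt`, and `g = 0` near `a₅`, then `Dφ(v) e → 0` as `v → (a₅, 0)` in the open
half-box, for every direction `e` with `e_last = 0`. [cite: Pawlucki2024, Lemma 5.4 (proof, (5.4.7))] -/
theorem tendsto_fderiv_tangential_zero {m : ℕ} {G Z : Set (Fin m → ℝ)} (hG : IsOpen G) (hZ : IsClosed Z) {η : ℝ} (hη : 0 < η)
    {φ : (Fin (m + 1) → ℝ) → ℝ} {g lam : (Fin m → ℝ) → ℝ}
    (hC1 : ContDiffOn ℝ 1 (bdExt φ g) (closedHalfBox (G \ Z) η))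
    (hD : ∀ a ∈ G \ Z, HasFDerivWithinAt (bdExt φ g)
      (fderiv ℝ (fun z : Fin (m + 1) → ℝ => g (Fin.init z)) (Fin.snoc a 0) + lam a • projL m) (closedHalfBox (G \ Z) η) (Fin.snoc a 0))
    {a₅ : Fin m → ℝ} {r₅ : ℝ} (hr₅ : 0 < r₅) (hball : ball a₅ r₅ ⊆ G \ Z) (hg0 : ∀ a ∈ ball a₅ r₅, g a = 0)
    (e : Fin (m + 1) → ℝ) (he : e (Fin.last m) = 0) :
    Tendsto (fun v => fderiv ℝ φ v e) (𝓝[halfBox (ball a₅ r₅) η] (Fin.snoc a₅ 0)) (𝓝 0) := by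
  set K := closedHalfBox (G \ Z) η with hK
  set p : Fin (m + 1) → ℝ := Fin.snoc a₅ 0 with hp
  have ha₅ : a₅ ∈ G \ Z := hball (mem_ball_self hr₅)
  have hpK : p ∈ K := snoc_mem_closedHalfBox.2 ⟨ha₅, le_rfl, hη⟩
  have hGZo : IsOpen (G \ Z) := hG.sdiff hZ
  have hUD : UniqueDiffOn ℝ K := uniqueDiffOn_closedHalfBox hGZo hη
  have hcont : ContinuousOn (fun z => fderivWithin ℝ (bdExt φ g) K z) K := hC1.continuousOn_fderivWithin hUD le_rfl
  -- the limit derivative at `p` kills tangential vectors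
  have hginit : fderiv ℝ (fun z : Fin (m + 1) → ℝ => g (Fin.init z)) p = 0 := by
    have hev : (fun z : Fin (m + 1) → ℝ => g (Fin.init z)) =ᶠ[𝓝 p] fun _ => 0 := by
      have hO : IsOpen {z : Fin (m + 1) → ℝ | (Fin.init z : Fin m → ℝ) ∈ ball a₅ r₅} :=
        isOpen_ball.preimage (continuous_pi fun i => continuous_apply _)
      have hpO : p ∈ {z : Fin (m + 1) → ℝ | (Fin.init z : Fin m → ℝ) ∈ ball a₅ r₅} := by
        show Fin.init p ∈ ball a₅ r₅; rw [hp, Fin.init_snoc]; exact mem_ball_self hr₅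
      filter_upwards [hO.mem_nhds hpO] with z hz
      exact hg0 _ hz
    rw [hev.fderiv_eq]; exact fderiv_const_apply 0
  have hLp : fderivWithin ℝ (bdExt φ g) K p = lam a₅ • projL m := by
    rw [(hD a₅ ha₅).fderivWithin (hUD p hpK), hginit, zero_add]
  have hlim : Tendsto (fun z => fderivWithin ℝ (bdExt φ g) K z) (𝓝[K] p) (𝓝 (lam a₅ • projL m)) := by
    rw [← hLp]; exact hcont p hpK
  -- restrict to the open half-box over the ball, where `fderivWithin = fderiv φ`
  have hsub : halfBox (ball a₅ r₅) η ⊆ K := fun z hz => ⟨hball hz.1, hz.2.1.le, hz.2.2⟩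
  have hlim' := hlim.mono_left (nhdsWithin_mono p hsub)
  have hev : ∀ᶠ v in 𝓝[halfBox (ball a₅ r₅) η] p, fderivWithin ℝ (bdExt φ g) K v e = fderiv ℝ φ v e := by
    filter_upwards [self_mem_nhdsWithin] with v hv
    have hvo : halfBox (G \ Z) η ∈ 𝓝 v := (isOpen_halfBox hGZo η).mem_nhds ⟨hball hv.1, hv.2.1, hv.2.2⟩
    have hKv : K ∈ 𝓝 v := Filter.mem_of_superset hvo halfBox_subset_closedHalfBox
    rw [fderivWithin_of_mem_nhds hKv]
    have heq : bdExt φ g =ᶠ[𝓝 v] φ := by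
      filter_upwards [hvo] with z hz
      simp only [bdExt, if_pos hz.2.1]
    rw [heq.fderiv_eq]
  have h2 : Tendsto (fun v => fderivWithin ℝ (bdExt φ g) K v e) (𝓝[halfBox (ball a₅ r₅) η] p) (𝓝 ((lam a₅ • projL m) e)) :=
    (ContinuousLinearMap.apply ℝ ℝ e).continuous.continuousAt.tendsto.comp hlim'
  have h0 : (lam a₅ • projL m) e = 0 := by simp [he]
  rw [h0] at h2
  exact h2.congr' hev

/-- **Pawłucki's wing argument** [Pawlucki2024, proof of Lemma 5.4, (5.4.3)–(5.4.8)], for `p = 1`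
and straightened spine: let `f` be semialgebraic and `C¹` on an open semialgebraic `U` containing the
punctured angle near the spine, with `y`-gradient bounded near each vertex and `|f| ≤ C ‖y‖` near
each vertex (i.e. spine limit `0`). Then for each tangential direction `u_i`, the set of vertex
points `a` at which `∂f/∂u_i` does not tend to `0` along the punctured angle has empty interior.
[cite: Pawlucki2024, Lemma 5.4 (proof, (5.4.3)–(5.4.8))] -/
theorem wing_interior_empty {Ω : Set (Fin k → ℝ)} (hΩ : IsOpen Ω) (j : ℕ) (T : Tower k (j + 1))
    (H : Tower.Hyp Ω (j + 1) T) (hAs : IsSemialgebraic ℝ (angle Ω (j + 1) T))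
    {f : (Fin (k + (j + 1)) → ℝ) → ℝ} {U : Set (Fin (k + (j + 1)) → ℝ)} (hUo : IsOpen U) (hUs : IsSemialgebraic ℝ U)
    (hfC1 : ContDiffOn ℝ 1 f U) (hfs : IsSemialgebraicFunOn ℝ U f)
    (hnear : ∀ a ∈ Ω, ∃ R > 0, ∀ z ∈ pAngle Ω (j + 1) T, dist z (spinePt (j + 1) a) < R → z ∈ U)
    (hgrad : ∀ a ∈ Ω, ∃ (R M : ℝ), 0 < R ∧ 0 ≤ M ∧ ∀ z ∈ pAngle Ω (j + 1) T, dist z (spinePt (j + 1) a) < R →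
      ∀ i' : Fin (j + 1), |fderiv ℝ f z (Pi.single (Fin.natAdd k i') 1)| ≤ M)
    (hsmall : ∀ a ∈ Ω, ∃ (R C : ℝ), 0 < R ∧ ∀ z ∈ pAngle Ω (j + 1) T, dist z (spinePt (j + 1) a) < R →
      |f z| ≤ C * ‖ypart (j + 1) z‖)
    (i : Fin k) :
    interior {a | a ∈ Ω ∧ ¬ Tendsto (fun z => fderiv ℝ f z (Pi.single (Fin.castAdd (j + 1) i) 1))
      (𝓝[pAngle Ω (j + 1) T] (spinePt (j + 1) a)) (𝓝 0)} = ∅ := by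
  classical
  by_contra hne
  obtain ⟨a₀, ha₀⟩ := nonempty_iff_ne_empty.2 hne
  obtain ⟨r₀, hr₀, hB₀⟩ := Metric.isOpen_iff.1 isOpen_interior a₀ ha₀
  have hbad := hB₀.trans interior_subset
  set h : (Fin (k + (j + 1)) → ℝ) → ℝ := fun z => fderiv ℝ f z (Pi.single (Fin.castAdd (j + 1) i) 1) with hh
  have hh_eq : h = partialDeriv f (Fin.castAdd (j + 1) i) := rfl
  have hhs : IsSemialgebraicFunOn ℝ U h := by
    rw [hh_eq]; exact isSemialgebraicFunOn_partialDeriv hUo hUs hfs (hfC1.differentiableOn one_ne_zero) _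
  have hpAs : IsSemialgebraic ℝ (pAngle Ω (j + 1) T) := isSemialgebraic_pAngle (j + 1) T hAs
  -- (W1)
  obtain ⟨N, a₁, r₁', hr₁', hB₁B₀', hclX⟩ := exists_uniform_level j T hnear h hr₀ hbad
  have ha₁Ω : a₁ ∈ Ω := (hbad (hB₁B₀' (mem_ball_self hr₁'))).1
  obtain ⟨Rn₁, hRn₁, hnear₁⟩ := hnear a₁ ha₁Ω
  set r₁ := min r₁' (Rn₁ / 2) with hr₁
  have hr₁pos : 0 < r₁ := lt_min hr₁' (half_pos hRn₁)
  set B₁ := ball a₁ r₁ with hB₁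
  have hB₁sub : B₁ ⊆ ball a₁ r₁' := ball_subset_ball (min_le_left _ _)
  have hB₁Ω : B₁ ⊆ Ω := fun a ha => (hbad (hB₁B₀' (hB₁sub ha))).1
  set ε : ℝ := 1 / (N + 1) with hε
  have hεpos : 0 < ε := by rw [hε]; positivity
  -- the set `X'` and its projection `P`
  set X' : Set (Fin (k + (j + 1)) → ℝ) := {z | z ∈ pAngle Ω (j + 1) T ∧ dist z (spinePt (j + 1) a₁) < Rn₁ ∧ ε ≤ |h z| ∧ upart (j + 1) z ∈ B₁} with hX'
  have hX'U : X' ⊆ U := fun z hz => hnear₁ z hz.1 hz.2.1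
  have hX'sub : X' ⊆ {z | z ∈ pAngle Ω (j + 1) T ∧ z ∈ U ∧ ε ≤ |h z|} := fun z hz => ⟨hz.1, hX'U hz, hz.2.2.1⟩
  have hX's : IsSemialgebraic ℝ X' := by
    have h1 : IsSemialgebraic ℝ {z : Fin (k + (j + 1)) → ℝ | z ∈ U ∧ ε ≤ |h z|} := by
      have heq : {z : Fin (k + (j + 1)) → ℝ | z ∈ U ∧ ε ≤ |h z|} = U \ {z | z ∈ U ∧ |h z| < ε} := by
        ext z; simp only [mem_setOf_eq, Set.mem_sdiff, not_and, not_lt]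
        exact ⟨fun ⟨h1, h2⟩ => ⟨h1, fun _ => h2⟩, fun ⟨h1, h2⟩ => ⟨h1, h2 h1⟩⟩
      rw [heq]; exact hUs.diff (LadderData.sa_sep_lt hhs.abs (isSemialgebraicFunOn_const' hUs ε))
    have h2 : IsSemialgebraic ℝ {z : Fin (k + (j + 1)) → ℝ | upart (j + 1) z ∈ B₁} :=
      (isSemialgebraic_ball a₁ r₁).preimage_comp (Fin.castAdd (j + 1))
    have h3 : IsSemialgebraic ℝ (ball (spinePt (j + 1) a₁) Rn₁ : Set (Fin (k + (j + 1)) → ℝ)) := isSemialgebraic_ball _ _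
    have heq : X' = pAngle Ω (j + 1) T ∩ ball (spinePt (j + 1) a₁) Rn₁ ∩ {z | z ∈ U ∧ ε ≤ |h z|} ∩ {z | upart (j + 1) z ∈ B₁} := by
      ext z; simp only [hX', mem_setOf_eq, mem_inter_iff, mem_ball]
      exact ⟨fun ⟨h1, h2, h3, h4⟩ => ⟨⟨⟨h1, h2⟩, hnear₁ z h1 h2, h3⟩, h4⟩, fun ⟨⟨⟨h1, h2⟩, _, h3⟩, h4⟩ => ⟨h1, h2, h3, h4⟩⟩
    rw [heq]; exact ((hpAs.inter h3).inter h1).inter h2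
  have hclX' : ∀ a ∈ B₁, spinePt (j + 1) a ∈ closure X' := by
    intro a ha
    have h1 := hclX a (hB₁sub ha)
    have hO : IsOpen ({z : Fin (k + (j + 1)) → ℝ | upart (j + 1) z ∈ B₁} ∩ ball (spinePt (j + 1) a₁) Rn₁) :=
      (isOpen_ball.preimage (continuous_upart (j + 1))).inter isOpen_ball
    have hmem : spinePt (j + 1) a ∈ {z : Fin (k + (j + 1)) → ℝ | upart (j + 1) z ∈ B₁} ∩ ball (spinePt (j + 1) a₁) Rn₁ := by
      refine ⟨by simpa [upart_spinePt] using ha, ?_⟩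
      rw [mem_ball, dist_spinePt_eq, upart_spinePt, ypart_spinePt, norm_zero, max_eq_left dist_nonneg]
      have := mem_ball.1 ha; rw [hr₁] at this
      exact (this.trans_le (min_le_right _ _)).trans (half_lt_self hRn₁)
    have h2 := mem_closure_inter_of_isOpen h1 hO hmem
    refine closure_mono (fun z hz => ?_) h2
    exact ⟨hz.1.1, mem_ball.1 hz.2.2, hz.1.2.2, hz.2.1⟩
  set P : Set (Fin (k + 1) → ℝ) := wbase j '' X' with hP
  have hPs : IsSemialgebraic ℝ P := hX's.image_proj (ιbase k j)
  have hPB : P ⊆ {v | Fin.init v ∈ B₁ ∧ 0 < v (Fin.last k)} := by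
    rintro v ⟨z, hz, rfl⟩
    refine ⟨?_, ?_⟩
    · show Fin.init (wbase j z) ∈ B₁
      rw [wbase_eq, Fin.init_snoc]; exact hz.2.2.2
    · show 0 < wbase j z (Fin.last k)
      rw [wbase_eq, Fin.snoc_last]; exact ypart_zero_pos_of_ne j T H hz.1.1 hz.1.2
  have hclP : ∀ a ∈ B₁, (Fin.snoc a 0 : Fin (k + 1) → ℝ) ∈ closure P := by
    intro a ha
    rw [← wbase_spinePt j a]
    exact image_closure_subset_closure_image (continuous_wbase j) ⟨_, hclX' a ha, rfl⟩
  -- the semialgebraic choice of the wing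
  set Zs : Set (Fin (k + 1 + j) → ℝ) := {w | w ∘ wingσ k j ∈ X'} with hZs
  have hZss : IsSemialgebraic ℝ Zs := hX's.preimage_comp (wingσ k j)
  obtain ⟨fs, -, hfsZ, hfs_sa, -, -, -⟩ := exists_semialgebraic_choice (k := ℝ) (m := k + 1) (n := j) hZss
  have happ : ∀ (v : Fin (k + 1) → ℝ) (y' : Fin j → ℝ), (Fin.append v y' ∈ Zs ↔ wasm j v y' ∈ X') := fun v y' => Iff.rfl
  have hdom : {v : Fin (k + 1) → ℝ | ∃ y', Fin.append v y' ∈ Zs} = P := by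
    ext v; constructor
    · rintro ⟨y', hy'⟩
      exact ⟨_, (happ v y').1 hy', wbase_wasm j v y'⟩
    · rintro ⟨z, hz, rfl⟩
      refine ⟨fun l => ypart (j + 1) z l.succ, (happ _ _).2 ?_⟩
      rw [wasm_wbase_tail]; exact hz
  have hwing : ∀ v ∈ P, wasm j v (fs v) ∈ X' := by
    intro v hv
    rw [← hdom] at hv
    exact (happ v (fs v)).1 (hfsZ v hv)
  set F : Fin j → (Fin (k + 1) → ℝ) → ℝ := fun l v => fs v l with hFdef
  have hFs : ∀ l, IsSemialgebraicFunOn ℝ P (F l) := by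
    intro l
    have h := hfs_sa
    rw [hdom] at h
    exact (isSemialgebraicMapOn_iff_forall_holds hPs).1 h l
  -- (W2)+(W3): the bottom band
  obtain ⟨S, ξ, hSo, hSs, hSne, hSB₁, hξc, hξpos, hbandP, hC1⟩ :=
    exists_bottom_band isOpen_ball (isSemialgebraic_ball a₁ r₁) ⟨a₁, mem_ball_self hr₁pos⟩ hPs hPB hclP F hFs
  -- (W4): constants at a point `a₂ ∈ S`
  obtain ⟨a₂, ha₂S⟩ := hSne
  have ha₂Ω : a₂ ∈ Ω := hB₁Ω (hSB₁ ha₂S)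
  obtain ⟨Rg, Mg, hRg, hMg, hgrad₂⟩ := hgrad a₂ ha₂Ω
  obtain ⟨Rs, Cs, hRs, hsmall₂⟩ := hsmall a₂ ha₂Ω
  obtain ⟨Csq, δsq, hCsq, hδsq, hsq⟩ := exists_norm_ypart_le' hΩ ha₂Ω j T H
  set Rmin := min Rg Rs with hRmin
  have hRmin : 0 < Rmin := lt_min hRg hRs
  -- the radii of the box
  obtain ⟨ρ₀, hρ₀, hρ₀S, hρ₀ξ⟩ : ∃ ρ₀ > 0, ball a₂ ρ₀ ⊆ S ∧ ∀ u ∈ ball a₂ ρ₀, ξ a₂ / 2 < ξ u := by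
    have h1 : ∀ᶠ u in 𝓝 a₂, u ∈ S := hSo.mem_nhds ha₂S
    have h2 : ∀ᶠ u in 𝓝 a₂, ξ a₂ / 2 < ξ u :=
      ((hξc a₂ ha₂S).continuousAt (hSo.mem_nhds ha₂S)).eventually (lt_mem_nhds (half_lt_self (hξpos a₂ ha₂S)))
    obtain ⟨ρ₀, hρ₀, hb⟩ := Metric.eventually_nhds_iff.1 (h1.and h2)
    exact ⟨ρ₀, hρ₀, fun u hu => (hb hu).1, fun u hu => (hb hu).2⟩
  set ρ := min ρ₀ (min δsq (Rmin / 2)) with hρ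
  have hρpos : 0 < ρ := lt_min hρ₀ (lt_min hδsq (half_pos hRmin))
  have hρρ₀ : ρ ≤ ρ₀ := min_le_left _ _
  have hρδsq : ρ ≤ δsq := (min_le_right _ _).trans (min_le_left _ _)
  have hρR : ρ ≤ Rmin / 2 := (min_le_right _ _).trans (min_le_right _ _)
  set δ₁ := min (ξ a₂ / 2) (min δsq (Rmin / (2 * (Csq + 1)))) with hδ₁
  have hδ₁pos : 0 < δ₁ := lt_min (half_pos (hξpos a₂ ha₂S)) (lt_min hδsq (div_pos hRmin (by positivity)))
  have hδ₁ξ : δ₁ ≤ ξ a₂ / 2 := min_le_left _ _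
  have hδ₁δsq : δ₁ ≤ δsq := (min_le_right _ _).trans (min_le_left _ _)
  have hδ₁R : Csq * δ₁ ≤ Rmin / 2 := by
    have h1 : δ₁ ≤ Rmin / (2 * (Csq + 1)) := (min_le_right _ _).trans (min_le_right _ _)
    have h2 : Csq * δ₁ ≤ Csq * (Rmin / (2 * (Csq + 1))) := mul_le_mul_of_nonneg_left h1 hCsq
    have h3 : Csq * (Rmin / (2 * (Csq + 1))) ≤ Rmin / 2 := by
      rw [mul_div_assoc', div_le_div_iff₀ (by positivity) two_pos]; nlinarith
    linarith
  set Box := halfBox (ball a₂ ρ) δ₁ with hBox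
  -- points of the box: in the band, in `P`; their wing points
  have hBoxP : ∀ v ∈ Box, v ∈ P := by
    intro v hv
    obtain ⟨hu, h0, hδ⟩ := (mem_halfBox_iff' v).1 hv
    refine hbandP v (hρ₀S (ball_subset_ball hρρ₀ hu)) h0 (hδ.trans_le (hδ₁ξ.trans (hρ₀ξ _ (ball_subset_ball hρρ₀ hu)).le))
  have hBoxband : Box ⊆ {z | Fin.init z ∈ S ∧ 0 < z (Fin.last k) ∧ z (Fin.last k) < ξ (Fin.init z)} := by
    intro v hv
    obtain ⟨hu, h0, hδ⟩ := (mem_halfBox_iff' v).1 hv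
    exact ⟨hρ₀S (ball_subset_ball hρρ₀ hu), h0, hδ.trans_le (hδ₁ξ.trans (hρ₀ξ _ (ball_subset_ball hρρ₀ hu)).le)⟩
  set W : (Fin (k + 1) → ℝ) → (Fin (k + (j + 1)) → ℝ) := fun v => wasm j v (fs v) with hW
  have hWX : ∀ v ∈ Box, W v ∈ X' := fun v hv => hwing v (hBoxP v hv)
  have hWu : ∀ v, upart (j + 1) (W v) = Fin.init v := fun v => upart_wasm j v _
  have hWy0 : ∀ v, ypart (j + 1) (W v) 0 = v (Fin.last k) := fun v => ypart_wasm_zero j v _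
  have hWyl : ∀ v l, ypart (j + 1) (W v) l.succ = F l v := fun v l => ypart_wasm_succ j v _ l
  have hWsq : ∀ v ∈ Box, ‖ypart (j + 1) (W v)‖ ≤ Csq * v (Fin.last k) := by
    intro v hv
    obtain ⟨hu, h0, hδ⟩ := (mem_halfBox_iff' v).1 hv
    have h := hsq (W v) (hWX v hv).1.1 (by rw [hWu]; exact (mem_ball.1 hu).trans_le hρδsq)
      (by rw [hWy0, abs_of_pos h0]; exact hδ.trans_le hδ₁δsq)
    rwa [hWy0, abs_of_pos h0] at h
  have hWdist : ∀ v ∈ Box, dist (W v) (spinePt (j + 1) a₂) < Rmin := by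
    intro v hv
    obtain ⟨hu, h0, hδ⟩ := (mem_halfBox_iff' v).1 hv
    rw [dist_spinePt_eq, hWu]
    refine max_lt ((mem_ball.1 hu).trans_le (hρR.trans (half_le_self hRmin.le)) |>.trans_le le_rfl) ?_
    calc ‖ypart (j + 1) (W v)‖ ≤ Csq * v (Fin.last k) := hWsq v hv
      _ ≤ Csq * δ₁ := mul_le_mul_of_nonneg_left hδ.le hCsq
      _ < Rmin := hδ₁R.trans_lt (half_lt_self hRmin)
  have hFbd : ∀ v ∈ Box, ∀ l, |F l v| ≤ Csq * v (Fin.last k) := by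
    intro v hv l
    rw [← hWyl v l]
    exact ((Real.norm_eq_abs _).symm.le.trans (norm_le_pi_norm (ypart (j + 1) (W v)) l.succ)).trans (hWsq v hv)
  have hgradW : ∀ v ∈ Box, ∀ i' : Fin (j + 1), |fderiv ℝ f (W v) (Pi.single (Fin.natAdd k i') 1)| ≤ Mg :=
    fun v hv i' => hgrad₂ _ (hWX v hv).1 ((hWdist v hv).trans_le (min_le_left _ _)) i'
  have hfW : ∀ v ∈ Box, |f (W v)| ≤ Cs * Csq * v (Fin.last k) := by
    intro v hv
    have h1 := hsmall₂ _ (hWX v hv).1 ((hWdist v hv).trans_le (min_le_right _ _))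
    have hCs : 0 ≤ Cs ∨ ypart (j + 1) (W v) = 0 := by
      by_cases hy : ypart (j + 1) (W v) = 0
      · exact Or.inr hy
      · left
        have hpos : 0 < ‖ypart (j + 1) (W v)‖ := norm_pos_iff.2 hy
        nlinarith [abs_nonneg (f (W v))]
    rcases hCs with hCs | hy
    · calc |f (W v)| ≤ Cs * ‖ypart (j + 1) (W v)‖ := h1
        _ ≤ Cs * (Csq * v (Fin.last k)) := mul_le_mul_of_nonneg_left (hWsq v hv) hCs
        _ = Cs * Csq * v (Fin.last k) := by ring
    · exact absurd hy (hWX v hv).1.2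
  -- `F l` is `C¹` and semialgebraic on the box
  have hBoxo : IsOpen Box := isOpen_halfBox (isOpen_ball (x := a₂) (ε := ρ)) δ₁
  have hFC1 : ∀ l, ContDiffOn ℝ 1 (F l) Box := by
    intro l
    obtain ⟨O, hO, hBO, F', hF', hEq⟩ := (hC1 l).mono hBoxband
    exact (hF'.mono hBO).congr fun v hv => (hEq hv).symm
  have hBoxs : IsSemialgebraic ℝ Box := isSemialgebraic_halfBox (isSemialgebraic_ball a₂ ρ) δ₁
  have hFsa : ∀ l, IsSemialgebraicFunOn ℝ Box (F l) := fun l => (hFs l).mono hBoxP hBoxs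
  have hdFsa : ∀ l, IsSemialgebraicFunOn ℝ Box (partialDeriv (F l) (Fin.last k)) := fun l =>
    isSemialgebraicFunOn_partialDeriv hBoxo hBoxs (hFsa l) ((hFC1 l).differentiableOn one_ne_zero) _
  have hdFc : ∀ l, ContinuousOn (partialDeriv (F l) (Fin.last k)) Box := by
    intro l
    have h := ((hFC1 l).continuousOn_fderiv_of_isOpen hBoxo le_rfl).clm_apply continuousOn_const (g := fun _ => Pi.single (Fin.last k) (1 : ℝ))
    exact h
  -- (W4a)+(W4b): uniform bound of `∂_t F l` on a smaller box
  have hpt : ∀ u ∈ ball a₂ ρ, ∀ l, ∃ (M η : ℝ), 0 < η ∧ ∀ t ∈ Ioo 0 η, |partialDeriv (F l) (Fin.last k) (Fin.snoc u t)| ≤ M := by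
    intro u hu l
    have hmem : ∀ t ∈ Ioo 0 δ₁, (Fin.snoc u t : Fin (k + 1) → ℝ) ∈ Box := fun t ht => snoc_mem_halfBox.2 ⟨hu, ht.1, ht.2⟩
    refine exists_bound_near_zero hδ₁pos (φc := fun t => F l (Fin.snoc u t)) (C := Csq) ?_ ?_ ?_ ?_
    · intro t ht
      exact hasDerivAt_normal_slice (((hFC1 l).differentiableOn one_ne_zero _ (hmem t ht)).differentiableAt (hBoxo.mem_nhds (hmem t ht)))
    · exact (hdFc l).comp (continuous_snoc_pair.comp (continuous_const.prodMk continuous_id)).continuousOn fun t ht => hmem t ht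
    · have hmap : IsSemialgebraicMapOn ℝ {z : Fin 1 → ℝ | z 0 ∈ Ioo 0 δ₁} (fun z => (Fin.snoc u (z 0) : Fin (k + 1) → ℝ)) := by
        have hI : IsSemialgebraic ℝ {z : Fin 1 → ℝ | z 0 ∈ Ioo 0 δ₁} := exists_bound_near_zero.sa_graph_aux hδ₁pos
        refine (isSemialgebraicMapOn_iff_forall_holds hI).2 fun idx => ?_
        refine Fin.lastCases ?_ (fun i'' => ?_) idx
        · simp only [Fin.snoc_last]; exact isSemialgebraicFunOn_apply hI 0
        · simp only [Fin.snoc_castSucc]; exact isSemialgebraicFunOn_const' hI (u i'')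
      exact IsSemialgebraicFunOn.comp_isSemialgebraicMapOn_holds (hdFsa l) hmap fun z hz => hmem _ hz
    · intro t ht
      have h := hFbd _ (hmem t ht) l
      rwa [Fin.snoc_last] at h
  obtain ⟨b', ρ', M', hρ', hballsub, hM'⟩ := exists_uniform_bound hρpos hδ₁pos (fun l => partialDeriv (F l) (Fin.last k)) hdFc hpt
  -- (W5): the smaller box and Theorem 5.3
  set Box' := halfBox (ball b' ρ') (δ₁ / 2) with hBox'
  have hB'B : Box' ⊆ Box := fun v hv => ⟨hballsub hv.1, hv.2.1, hv.2.2.trans (half_lt_self hδ₁pos)⟩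
  have hBox's : IsSemialgebraic ℝ Box' := isSemialgebraic_halfBox (isSemialgebraic_ball b' ρ') _
  have hη : 0 < δ₁ / 2 := half_pos hδ₁pos
  have hM'Box : ∀ v ∈ Box', ∀ l, |partialDeriv (F l) (Fin.last k) v| ≤ M' := by
    intro v hv l
    have h := hM' (Fin.init v) hv.1 (v (Fin.last k)) ⟨hv.2.1, hv.2.2.le⟩ l
    rwa [Fin.snoc_init_self] at h
  have hTHM : ∀ l, ∃ (Z : Set (Fin k → ℝ)) (g lam : (Fin k → ℝ) → ℝ), IsSemialgebraic ℝ Z ∧ IsClosed Z ∧ IsSmall Z ∧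
      (∀ a ∈ ball b' ρ' \ Z, Tendsto (F l) (𝓝[Box'] (Fin.snoc a 0)) (𝓝 (g a))) ∧
      ContDiffOn ℝ 1 (bdExt (F l) g) (closedHalfBox (ball b' ρ' \ Z) (δ₁ / 2)) ∧
      ∀ a ∈ ball b' ρ' \ Z, HasFDerivWithinAt (bdExt (F l) g)
        (fderiv ℝ (fun z : Fin (k + 1) → ℝ => g (Fin.init z)) (Fin.snoc a 0) + lam a • projL k)
        (closedHalfBox (ball b' ρ' \ Z) (δ₁ / 2)) (Fin.snoc a 0) := by
    intro l
    obtain ⟨Z, g, lam, hZs, hZc, hZsm, -, -, -, hT, -, hC1e, hDe⟩ := c1_extension_halfBox isOpen_ball (isSemialgebraic_ball b' ρ') hη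
      ((hFC1 l).mono hB'B) ((hFsa l).mono hB'B hBox's) (fun v hv => hM'Box v hv l)
    exact ⟨Z, g, lam, hZs, hZc, hZsm, hT, hC1e, hDe⟩
  choose Zl gl laml hZls hZlc hZlsm hTl hC1l hDl using hTHM
  -- the composite `FF = f ∘ W`
  set FF : (Fin (k + 1) → ℝ) → ℝ := fun v => f (W v) with hFF
  have hWder : ∀ v ∈ Box, HasFDerivAt W (wingCLM k j fun l => fderiv ℝ (F l) v) v := by
    intro v hv
    exact hasFDerivAt_wingMap j fun l => (((hFC1 l).differentiableOn one_ne_zero) v hv).differentiableAt (hBoxo.mem_nhds hv) |>.hasFDerivAt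
  have hWC1 : ContDiffOn ℝ 1 W Box := by
    rw [contDiffOn_pi]
    intro idx
    refine Fin.addCases (fun i'' => ?_) (fun l' => ?_) idx
    · have h : (fun v => W v (Fin.castAdd (j + 1) i'')) = fun v => v i''.castSucc := funext fun v => wasm_apply_castAdd j v _ i''
      rw [h]; exact (contDiff_apply ℝ ℝ i''.castSucc).contDiffOn
    · refine Fin.cases ?_ (fun l => ?_) l'
      · have h : (fun v => W v (Fin.natAdd k (0 : Fin (j + 1)))) = fun v => v (Fin.last k) := funext fun v => wasm_apply_natAdd_zero j v _
        rw [h]; exact (contDiff_apply ℝ ℝ (Fin.last k)).contDiffOn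
      · have h : (fun v => W v (Fin.natAdd k l.succ)) = F l := funext fun v => wasm_apply_natAdd_succ j v _ l
        rw [h]; exact hFC1 l
  have hWU : MapsTo W Box U := fun v hv => hX'U (hWX v hv)
  have hFFC1 : ContDiffOn ℝ 1 FF Box := hfC1.comp hWC1 hWU
  have hWsa : IsSemialgebraicMapOn ℝ Box W := by
    refine (isSemialgebraicMapOn_iff_forall_holds hBoxs).2 fun idx => ?_
    refine Fin.addCases (fun i'' => ?_) (fun l' => ?_) idx
    · have h : (fun v => W v (Fin.castAdd (j + 1) i'')) = fun v => v i''.castSucc := funext fun v => wasm_apply_castAdd j v _ i''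
      rw [h]; exact isSemialgebraicFunOn_apply hBoxs _
    · refine Fin.cases ?_ (fun l => ?_) l'
      · have h : (fun v => W v (Fin.natAdd k (0 : Fin (j + 1)))) = fun v => v (Fin.last k) := funext fun v => wasm_apply_natAdd_zero j v _
        rw [h]; exact isSemialgebraicFunOn_apply hBoxs _
      · have h : (fun v => W v (Fin.natAdd k l.succ)) = F l := funext fun v => wasm_apply_natAdd_succ j v _ l
        rw [h]; exact hFsa l
  have hFFsa : IsSemialgebraicFunOn ℝ Box FF := IsSemialgebraicFunOn.comp_isSemialgebraicMapOn_holds hfs hWsa hWU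
  have hfder : ∀ v ∈ Box, HasFDerivAt f (fderiv ℝ f (W v)) (W v) := fun v hv =>
    ((hfC1.differentiableOn one_ne_zero _ (hWU hv)).differentiableAt (hUo.mem_nhds (hWU hv))).hasFDerivAt
  have hFFder : ∀ v ∈ Box, ∀ e, fderiv ℝ FF v e = fderiv ℝ f (W v) (wasm j e fun l => fderiv ℝ (F l) v e) := by
    intro v hv e
    rw [show FF = f ∘ W from rfl, ((hfder v hv).comp v (hWder v hv)).fderiv, ContinuousLinearMap.comp_apply, wingCLM_apply]
  -- the normal derivative of `FF` is bounded on `Box'`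
  set MF : ℝ := (1 + |M'|) * Mg * (j + 1) with hMF
  have hFFbd : ∀ v ∈ Box', |partialDeriv FF (Fin.last k) v| ≤ MF := by
    intro v hv
    have hvB := hB'B hv
    rw [partialDeriv, hFFder v hvB, wasm_single_last, map_sum]
    have hterm : ∀ i' : Fin (j + 1), |fderiv ℝ f (W v) ((Fin.cons 1 (fun l => fderiv ℝ (F l) v (Pi.single (Fin.last k) 1)) : Fin (j + 1) → ℝ) i' •
        (Pi.single (Fin.natAdd k i') (1 : ℝ) : Fin (k + (j + 1)) → ℝ))| ≤ (1 + |M'|) * Mg := by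
      intro i'
      rw [map_smul, smul_eq_mul, abs_mul]
      refine mul_le_mul ?_ (hgradW v hvB i') (abs_nonneg _) (by positivity)
      refine Fin.cases ?_ (fun l => ?_) i'
      · simp
      · rw [Fin.cons_succ]
        have h := hM'Box v hv l
        rw [partialDeriv] at h
        exact h.trans ((le_abs_self M').trans (by linarith [abs_nonneg M']))
    calc |∑ i' : Fin (j + 1), fderiv ℝ f (W v) ((Fin.cons 1 (fun l => fderiv ℝ (F l) v (Pi.single (Fin.last k) 1)) : Fin (j + 1) → ℝ) i' •
          (Pi.single (Fin.natAdd k i') (1 : ℝ) : Fin (k + (j + 1)) → ℝ))|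
        ≤ ∑ i' : Fin (j + 1), |fderiv ℝ f (W v) ((Fin.cons 1 (fun l => fderiv ℝ (F l) v (Pi.single (Fin.last k) 1)) : Fin (j + 1) → ℝ) i' •
          (Pi.single (Fin.natAdd k i') (1 : ℝ) : Fin (k + (j + 1)) → ℝ))| := Finset.abs_sum_le_sum_abs _ _
      _ ≤ ∑ _i' : Fin (j + 1), (1 + |M'|) * Mg := Finset.sum_le_sum fun i' _ => hterm i'
      _ = MF := by rw [Finset.sum_const, Finset.card_univ, Fintype.card_fin, nsmul_eq_mul, hMF]; push_cast; ring
  obtain ⟨ZF, gF, lamF, hZFs, hZFc, hZFsm, -, -, -, hTF, -, hC1F, hDF⟩ := c1_extension_halfBox isOpen_ball (isSemialgebraic_ball b' ρ') hη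
    (hFFC1.mono hB'B) (hFFsa.mono hB'B hBox's) hFFbd
  -- boundary values vanish
  have hlim0 : ∀ {φ : (Fin (k + 1) → ℝ) → ℝ} {C : ℝ}, (∀ v ∈ Box', |φ v| ≤ C * v (Fin.last k)) →
      ∀ a ∈ ball b' ρ', ∀ c : ℝ, Tendsto φ (𝓝[Box'] (Fin.snoc a 0)) (𝓝 c) → c = 0 := by
    intro φ C hφ a ha c hc
    have h0 : Tendsto φ (𝓝[Box'] (Fin.snoc a 0)) (𝓝 0) := by
      have hb : ∀ᶠ v in 𝓝[Box'] (Fin.snoc a 0 : Fin (k + 1) → ℝ), ‖φ v‖ ≤ C * v (Fin.last k) := by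
        filter_upwards [self_mem_nhdsWithin] with v hv
        rw [Real.norm_eq_abs]; exact hφ v hv
      have hl : Tendsto (fun v : Fin (k + 1) → ℝ => C * v (Fin.last k)) (𝓝[Box'] (Fin.snoc a 0)) (𝓝 0) := by
        have h : Tendsto (fun v : Fin (k + 1) → ℝ => C * v (Fin.last k)) (𝓝 (Fin.snoc a 0 : Fin (k + 1) → ℝ)) (𝓝 (C * (Fin.snoc a (0 : ℝ) : Fin (k + 1) → ℝ) (Fin.last k))) :=
          (continuous_const.mul (continuous_apply _)).tendsto _
        rw [Fin.snoc_last, mul_zero] at h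
        exact h.mono_left nhdsWithin_le_nhds
      exact squeeze_zero_norm' hb hl
    haveI := neBot_nhdsWithin_halfBox (G := ball b' ρ') hη ha
    exact tendsto_nhds_unique hc h0
  have hgl0 : ∀ l, ∀ a ∈ ball b' ρ' \ Zl l, gl l a = 0 := fun l a ha =>
    hlim0 (fun v hv => hFbd v (hB'B hv) l) a ha.1 _ (hTl l a ha)
  have hgF0 : ∀ a ∈ ball b' ρ' \ ZF, gF a = 0 := fun a ha =>
    hlim0 (C := Cs * Csq) (fun v hv => hfW v (hB'B hv)) a ha.1 _ (hTF a ha)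
  -- a good base point `a₅`
  set E : Set (Fin k → ℝ) := ZF ∪ ⋃ l ∈ (Finset.univ : Finset (Fin j)), Zl l with hE
  have hEc : IsClosed E := hZFc.union (isClosed_biUnion_finset fun l _ => hZlc l)
  have hEsm : IsSmall E := hZFsm.union (isSmall_biUnion _ (fun l _ => hZlsm l) fun l _ => hZls l) hZFs
    (IsSemialgebraic.biUnion _ _ fun l _ => hZls l)
  obtain ⟨a₅, ha₅, ha₅E⟩ := exists_mem_not_mem_of_isSmall hEsm isOpen_ball ⟨b', mem_ball_self hρ'⟩
  obtain ⟨r₅, hr₅, hball₅⟩ := Metric.isOpen_iff.1 (isOpen_ball.sdiff hEc) a₅ ⟨ha₅, ha₅E⟩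
  have hball₅F : ball a₅ r₅ ⊆ ball b' ρ' \ ZF := fun u hu => ⟨(hball₅ hu).1, fun h => (hball₅ hu).2 (Or.inl h)⟩
  have hball₅l : ∀ l, ball a₅ r₅ ⊆ ball b' ρ' \ Zl l := fun l u hu =>
    ⟨(hball₅ hu).1, fun h => (hball₅ hu).2 (Or.inr (mem_iUnion₂.2 ⟨l, Finset.mem_univ l, h⟩))⟩
  -- tangential limits at `(a₅, 0)`
  set e : Fin (k + 1) → ℝ := Pi.single i.castSucc 1 with he
  have he0 : e (Fin.last k) = 0 := by rw [he]; simp [(Fin.castSucc_lt_last i).ne']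
  set Box₅ := halfBox (ball a₅ r₅) (δ₁ / 2) with hBox₅
  have hB₅B' : Box₅ ⊆ Box' := fun v hv => ⟨(hball₅ hv.1).1, hv.2⟩
  have hTl0 : ∀ l, Tendsto (fun v => fderiv ℝ (F l) v e) (𝓝[Box₅] (Fin.snoc a₅ 0)) (𝓝 0) := fun l =>
    tendsto_fderiv_tangential_zero isOpen_ball (hZlc l) hη (hC1l l) (hDl l) hr₅ (hball₅l l) (fun a ha => hgl0 l a (hball₅l l ha)) e he0
  have hTF0 : Tendsto (fun v => fderiv ℝ FF v e) (𝓝[Box₅] (Fin.snoc a₅ 0)) (𝓝 0) :=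
    tendsto_fderiv_tangential_zero isOpen_ball hZFc hη hC1F hDF hr₅ hball₅F (fun a ha => hgF0 a (hball₅F ha)) e he0
  -- the chain rule along `e`: `h (W v) = D FF(v) e - Σ_l (D F_l(v) e) · ∂f/∂y_{l+1}(W v)`
  have hchain : ∀ v ∈ Box, h (W v) = fderiv ℝ FF v e - ∑ l : Fin j, fderiv ℝ (F l) v e * fderiv ℝ f (W v) (Pi.single (Fin.natAdd k l.succ) 1) := by
    intro v hv
    rw [hFFder v hv e, he, wasm_single_castSucc, map_add, map_sum]
    simp only [map_smul, smul_eq_mul]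
    show fderiv ℝ f (W v) (Pi.single (Fin.castAdd (j + 1) i) 1) = _
    ring
  have hlimh : Tendsto (fun v => h (W v)) (𝓝[Box₅] (Fin.snoc a₅ 0)) (𝓝 0) := by
    have hterm : ∀ l : Fin j, Tendsto (fun v => fderiv ℝ (F l) v e * fderiv ℝ f (W v) (Pi.single (Fin.natAdd k l.succ) 1))
        (𝓝[Box₅] (Fin.snoc a₅ 0)) (𝓝 0) := by
      intro l
      have hb : ∀ᶠ v in 𝓝[Box₅] (Fin.snoc a₅ 0 : Fin (k + 1) → ℝ), ‖fderiv ℝ (F l) v e * fderiv ℝ f (W v) (Pi.single (Fin.natAdd k l.succ) 1)‖ ≤ Mg * ‖fderiv ℝ (F l) v e‖ := by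
        filter_upwards [self_mem_nhdsWithin] with v hv
        rw [norm_mul, mul_comm Mg]
        exact mul_le_mul_of_nonneg_left ((Real.norm_eq_abs _).le.trans (hgradW v (hB'B (hB₅B' hv)) l.succ)) (norm_nonneg _)
      have hl : Tendsto (fun v => Mg * ‖fderiv ℝ (F l) v e‖) (𝓝[Box₅] (Fin.snoc a₅ 0)) (𝓝 0) := by
        have := (hTl0 l).norm; rw [norm_zero] at this
        have h := this.const_mul Mg; rwa [mul_zero] at h
      exact squeeze_zero_norm' hb hl
    have hsum : Tendsto (fun v => ∑ l : Fin j, fderiv ℝ (F l) v e * fderiv ℝ f (W v) (Pi.single (Fin.natAdd k l.succ) 1))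
        (𝓝[Box₅] (Fin.snoc a₅ 0)) (𝓝 0) := by
      have h := tendsto_finsetSum (Finset.univ : Finset (Fin j)) fun l _ => hterm l
      simpa using h
    have h := hTF0.sub hsum
    rw [sub_zero] at h
    refine h.congr' ?_
    filter_upwards [self_mem_nhdsWithin] with v hv
    exact (hchain v (hB'B (hB₅B' hv))).symm
  -- contradiction with `ε ≤ |h|` on the wing
  have hev : ∀ᶠ v in 𝓝[Box₅] (Fin.snoc a₅ 0 : Fin (k + 1) → ℝ), |h (W v)| < ε := by
    have := Metric.tendsto_nhds.1 hlimh ε hεpos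
    refine this.mono fun v hv => ?_
    rwa [Real.dist_eq, sub_zero] at hv
  haveI := neBot_nhdsWithin_halfBox (G := ball a₅ r₅) hη (mem_ball_self hr₅)
  obtain ⟨v, hvlt, hv⟩ := (hev.and self_mem_nhdsWithin).exists
  have hge : ε ≤ |h (W v)| := (hWX v (hB'B (hB₅B' hv))).2.2.1
  exact absurd hvlt (not_lt.2 hge)

end Main

end Literature.ModelTheory.ExponentialFields
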